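import Literature.Probability.Percolation.TriDiscreteDomain
import Mathlib.Combinatorics.Enumerative.DoubleCounting
import HarnessLib

/-!
# Shelling of discrete discs of `𝕋`: the combinatorial topology of discrete domains, I

Topic `Literature/Probability/Percolation`. Toolkit for the discrete-topology facts of
Bollobás–Riordan, *Percolation* (2006), Ch. 7 (Lemma 5 and the separation statements of
§7.2.4–7.2.6), first part: a **discrete Gauss–Bonnet formula** and the **shelling** of a disc of
hexagons, which replace appeals to the Jordan curve theorem by inductions.

* `triDir j` (`j : Fin 6`) — the six lattice directions in anticlockwise order,
  `e₀, e₁, e₁ - e₀, -e₀, -e₁, e₀ - e₁`; `triDir (j + 1) = R (triDir j)` (`triRot60`).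
* `facesAt u` — the six faces of `𝕋` at the site `u`; `faceDart w j` — the three darts of the
  face `w` in anticlockwise order; `leftFace u v` — the face to the left of the dart `u → v`
  (apex `triLeftApex u v`; equal to the tree's `triFace u v (triLeftApex u v)`, the first
  component of `triEdgeFaces`, by `leftFace_eq_triFace`), via the direction table `leftFaceDir`.
* `triTurn G d = ± 1` — the turn of the boundary of `⋃_{v ∈ G} H_v` after the boundary dart `d`:
  `+1` (left, around the hexagon of the tail) if the apex of the left face is outside `G`, `-1`
  (right, around the hexagon of the head) if it is inside.
* **`sum_triTurn_eq`** (discrete Gauss–Bonnet): `∑_{d ∈ ∂G} triTurn G d = 3 · triEulerTwice G`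
  (`= 6 χ`), by double counting: the faces with exactly one (resp. two) vertices in `G` are the
  left faces of the boundary darts turning left (resp. right), and
  `6 V = F₁ + 2 F₂ + 3 F₃`, `2 E = F₂ + 3 F₃`.
* `IsTriDisc G b` — the boundary darts form one cycle under `triBdrySucc`, traversed from `b`,
  and `χ = 1` (the unmarked part of `TriMarkedDomain`); periodicity, injectivity on a period,
  `rebase`, `sum_triTurn_range = 6` (one full turn).
* **`IsTriDisc.exists_isOuterBlock`** — in a disc with `≥ 2` hexagons some site has its outside
  neighbours in one block of `3, 4` or `5` consecutive directions: `6 = Σ_sites score`, a site of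
  positive score exists, and positive score forces a single block (a check over the `64`
  patterns, `exists_isOuterBlock_of_patternScore_pos`).
* `RemovableAt G u a m` — the outside neighbours of `u` are those in directions
  `a, …, a + m - 1`; the block occupies the last `m` positions of the traversal from `dPlus`
  (`iter_block`, `iter_dMinus`), the boundary of `G ∖ {u}` is the old cycle with the block
  replaced by the `6 - m` darts into `u` (`iter_erase_eq`, `card_triBdryDarts_erase`), and
  `χ` is unchanged (`triEulerTwice_erase`: `V - 1`, `E - (6 - m)`, `F - (5 - m)`); hence
  **`RemovableAt.isTriDisc_erase`** and the **shelling theorem** `IsTriDisc.exists_removableAt`.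

## References

* B. Bollobás, O. Riordan, *Percolation*, Cambridge University Press (2006), Ch. 7 §7.2.2
  p. 168 (discrete domains: "the union of the closed hexagons is simply connected"; the boundary
  "is a simple cycle in the hexagonal lattice. Following this cycle in an anticlockwise
  direction …").

## Mathlib / tree

Mathlib: `Finset.sum_card_bipartiteAbove_eq_sum_card_bipartiteBelow` (double counting),
`Finset.card_bij`, `Fin.ofNat`. Tree: `triGraph`, `hexFaceVertices`, `triRot60`, `triLeftApex`,
`triFace`/`triEdgeFaces` (the left face of a dart; `leftFace_eq_triFace` bridges the direction
table `leftFaceDir` used here to them), `triFace_add`, `triBdryDarts`, `triBdrySucc`,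
`triAdjPairs`, `triFacesIn`, `triEulerTwice`, `faceVertex` (`TriangularLattice(Proofs).lean`,
`TriDiscreteDomain.lean`).
-/

noncomputable section

open Finset

namespace Literature.Probability.Percolation

/-! ### The six directions -/

/-- The six unit vectors of `𝕋` in anticlockwise order: `e₀, e₁, e₁ - e₀, -e₀, -e₁, e₀ - e₁`
(at angles `0, 60°, …, 300°` in the embedding). [folklore] -/
def triDir : Fin 6 → LatticeModels.Site 2 :=
  ![Pi.single 0 1, Pi.single 1 1, -Pi.single 0 1 + Pi.single 1 1, -Pi.single 0 1,
    -Pi.single 1 1, Pi.single 0 1 - Pi.single 1 1]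

/-- Rotation by `60°` advances the directions. [folklore] -/
theorem triRot60_triDir (j : Fin 6) : LatticeModels.triRot60 (triDir j) = triDir (j + 1) := by
  fin_cases j <;> (ext i; fin_cases i <;> simp [LatticeModels.triRot60, triDir])

/-- The directions are nonzero. [folklore] -/
theorem triDir_ne_zero (j : Fin 6) : triDir j ≠ 0 := by
  intro h
  fin_cases j
  · simpa [triDir] using congrFun h 0
  · simpa [triDir] using congrFun h 1
  · simpa [triDir] using congrFun h 1
  · simpa [triDir] using congrFun h 0
  · simpa [triDir] using congrFun h 1
  · simpa [triDir] using congrFun h 0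

/-- The sum of consecutive-but-one directions: `triDir j + triDir (j + 2) = triDir (j + 1)`
(the hexagon identity `e₀ + (e₁ - e₀) = e₁`). [folklore] -/
theorem triDir_add_triDir_add_two (j : Fin 6) : triDir j + triDir (j + 2) = triDir (j + 1) := by
  fin_cases j <;> (ext i; fin_cases i <;> simp [triDir])

/-- Opposite directions: `triDir (j + 3) = - triDir j`. [folklore] -/
theorem triDir_add_three (j : Fin 6) : triDir (j + 3) = -triDir j := by
  fin_cases j <;> (ext i; fin_cases i <;> simp [triDir])

/-- **Adjacency in `𝕋` by directions**: `x ∼ y` iff `y = x + triDir j` for some `j`. [folklore] -/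
theorem triGraph_adj_iff_triDir (x y : LatticeModels.Site 2) : LatticeModels.triGraph.Adj x y ↔ ∃ j, y = x + triDir j := by
  rw [LatticeModels.triGraph_adj_iff_eq_add]
  have h2 : -Pi.single 0 1 + Pi.single 1 1 = -(LatticeModels.triDiag : LatticeModels.Site 2) := by
    ext i; fin_cases i <;> simp [LatticeModels.triDiag]
  have h5 : Pi.single 0 1 - Pi.single 1 1 = (LatticeModels.triDiag : LatticeModels.Site 2) := by
    ext i; fin_cases i <;> simp [LatticeModels.triDiag]
  constructor
  · rintro (h | h | h | h | h | h)
    · exact ⟨0, by simpa [triDir] using h⟩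
    · exact ⟨3, by simpa [triDir] using h⟩
    · exact ⟨1, by simpa [triDir] using h⟩
    · exact ⟨4, by simpa [triDir] using h⟩
    · exact ⟨5, by rw [h]; simp only [triDir, Matrix.cons_val]; rw [h5]⟩
    · exact ⟨2, by rw [h]; simp only [triDir, Matrix.cons_val]; rw [h2]⟩
  · rintro ⟨j, rfl⟩
    fin_cases j
    · exact Or.inl (by simp [triDir])
    · exact Or.inr (Or.inr (Or.inl (by simp [triDir])))
    · exact Or.inr (Or.inr (Or.inr (Or.inr (Or.inr (by simp [triDir, h2])))))
    · exact Or.inr (Or.inl (by simp [triDir]))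
    · exact Or.inr (Or.inr (Or.inr (Or.inl (by simp [triDir]))))
    · exact Or.inr (Or.inr (Or.inr (Or.inr (Or.inl (by simp [triDir, h5])))))

/-- `x ∼ x + triDir j`. [folklore] -/
theorem triGraph_adj_add_triDir (x : LatticeModels.Site 2) (j : Fin 6) : LatticeModels.triGraph.Adj x (x + triDir j) :=
  (triGraph_adj_iff_triDir x _).2 ⟨j, rfl⟩

/-- `triDir` is injective. [folklore] -/
theorem triDir_injective : Function.Injective triDir := by
  intro i j h
  have h0 := congrFun h 0
  have h1 := congrFun h 1
  fin_cases i <;> fin_cases j <;> first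
    | rfl
    | (exfalso; simp [triDir] at h0 h1)

/-- The apex of the left face of the dart `x → x + triDir j` is `x + triDir (j + 1)`. [folklore] -/
theorem triLeftApex_add_triDir (x : LatticeModels.Site 2) (j : Fin 6) :
    triLeftApex x (x + triDir j) = x + triDir (j + 1) := by
  rw [triLeftApex, add_sub_cancel_left, triRot60_triDir]

/-- The apex of the left face of the dart `x + triDir j → x` is `x + triDir (j - 1)`. [folklore] -/
theorem triLeftApex_add_triDir_left (x : LatticeModels.Site 2) (j : Fin 6) :
    triLeftApex (x + triDir j) x = x + triDir (j + 5) := by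
  fin_cases j <;> (ext i; fin_cases i <;> simp [triLeftApex, LatticeModels.triRot60, triDir])

/-- The direction index of an adjacent pair: `v = u + triDir (dirOf u v)` (junk `0` if `u ≁ v`). [folklore] -/
def dirOf (u v : LatticeModels.Site 2) : Fin 6 :=
  if h : ∃ j, v = u + triDir j then h.choose else 0

/-- `dirOf` recovers the direction. [folklore] -/
@[simp] theorem dirOf_add_triDir (u : LatticeModels.Site 2) (j : Fin 6) : dirOf u (u + triDir j) = j := by
  have h : ∃ i, u + triDir j = u + triDir i := ⟨j, rfl⟩
  rw [dirOf, dif_pos h]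
  exact triDir_injective (add_left_cancel h.choose_spec).symm

/-- Adjacent sites differ by the direction `dirOf`. [folklore] -/
theorem eq_add_triDir_dirOf {u v : LatticeModels.Site 2} (h : LatticeModels.triGraph.Adj u v) : v = u + triDir (dirOf u v) := by
  obtain ⟨j, rfl⟩ := (triGraph_adj_iff_triDir u v).1 h
  rw [dirOf_add_triDir]

/-! ### Faces at a site, darts of a face, the left face of a dart -/

/-- Existential quantification over `Fin 3`, unfolded. [folklore] -/
private theorem exists_fin_three {P : Fin 3 → Prop} : (∃ j, P j) ↔ P 0 ∨ P 1 ∨ P 2 := by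
  constructor
  · rintro ⟨j, h⟩
    fin_cases j
    · exact Or.inl h
    · exact Or.inr (Or.inl h)
    · exact Or.inr (Or.inr h)
  · rintro (h | h | h) <;> exact ⟨_, h⟩

/-- The vertices of a face are its three anticlockwise-labelled vertices. [folklore] -/
theorem hexFaceVertices_eq_image_faceVertex (w : LatticeModels.HexVertex) :
    LatticeModels.hexFaceVertices w = univ.image (faceVertex w) := by
  rcases w with ⟨x, t⟩
  ext z
  simp only [mem_image, mem_univ, true_and, exists_fin_three]
  by_cases ht : t = 0
  · subst ht
    simp only [LatticeModels.mem_hexFaceVertices_zero, faceVertex, Fin.isValue, ↓reduceIte, Matrix.cons_val_zero,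
      Matrix.cons_val_one, Matrix.cons_val]
    constructor
    · rintro (h | h | h) <;> simp [h]
    · rintro (h | h | h) <;> simp [← h]
  · obtain rfl : t = 1 := by
      rcases Fin.exists_fin_two.1 ⟨t, rfl⟩ with h | h
      · exact (ht h).elim
      · exact h
    simp only [LatticeModels.mem_hexFaceVertices_one, faceVertex, Fin.isValue, one_ne_zero, ↓reduceIte,
      Matrix.cons_val_zero, Matrix.cons_val_one, Matrix.cons_val]
    constructor
    · rintro (h | h | h)
      · exact Or.inl h.symm
      · exact Or.inr (Or.inr h.symm)
      · exact Or.inr (Or.inl (by rw [h, add_assoc]))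
    · rintro (h | h | h)
      · exact Or.inl h.symm
      · exact Or.inr (Or.inr (by rw [← h, add_assoc]))
      · exact Or.inr (Or.inl h.symm)

/-- Membership in a face in terms of the labelled vertices. [folklore] -/
theorem mem_hexFaceVertices_iff_faceVertex {w : LatticeModels.HexVertex} {z : LatticeModels.Site 2} :
    z ∈ LatticeModels.hexFaceVertices w ↔ ∃ j, z = faceVertex w j := by
  rw [hexFaceVertices_eq_image_faceVertex]
  simp only [mem_image, mem_univ, true_and]
  exact ⟨fun ⟨j, h⟩ => ⟨j, h.symm⟩, fun ⟨j, h⟩ => ⟨j, h.symm⟩⟩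

/-- The direction of the `j`-th anticlockwise dart of a face: `0, 2, 4` around an up face,
`1, 3, 5` around a down face. [folklore] -/
def faceDartDir (w : LatticeModels.HexVertex) (j : Fin 3) : Fin 6 :=
  if w.2 = 0 then ![0, 2, 4] j else ![1, 3, 5] j

/-- Consecutive anticlockwise vertices differ by the dart direction. [folklore] -/
theorem faceVertex_succ (w : LatticeModels.HexVertex) (j : Fin 3) :
    faceVertex w (j + 1) = faceVertex w j + triDir (faceDartDir w j) := by
  rcases w with ⟨x, t⟩
  by_cases ht : t = 0
  · subst ht
    fin_cases j <;> (ext i; fin_cases i <;> simp [faceVertex, faceDartDir, triDir])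
  · obtain rfl : t = 1 := by
      rcases Fin.exists_fin_two.1 ⟨t, rfl⟩ with h | h
      · exact (ht h).elim
      · exact h
    fin_cases j <;> (ext i; fin_cases i <;> simp [faceVertex, faceDartDir, triDir])

/-- The labelled vertices of a face are distinct. [folklore] -/
theorem faceVertex_injective (w : LatticeModels.HexVertex) : Function.Injective (faceVertex w) := by
  intro i j h
  rcases w with ⟨x, t⟩
  by_cases ht : t = 0
  · subst ht
    fin_cases i <;> fin_cases j <;> first
      | rfl
      | (exfalso
         have h0 := congrFun h 0; have h1 := congrFun h 1
         simp [faceVertex] at h0 h1)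
  · obtain rfl : t = 1 := by
      rcases Fin.exists_fin_two.1 ⟨t, rfl⟩ with h' | h'
      · exact (ht h').elim
      · exact h'
    fin_cases i <;> fin_cases j <;> first
      | rfl
      | (exfalso
         have h0 := congrFun h 0; have h1 := congrFun h 1
         simp [faceVertex] at h0 h1)

/-- A face has three vertices. [folklore] -/
theorem card_hexFaceVertices (w : LatticeModels.HexVertex) : #(LatticeModels.hexFaceVertices w) = 3 := by
  rw [hexFaceVertices_eq_image_faceVertex, card_image_of_injective _ (faceVertex_injective w)]
  rfl

/-- **The apex of the left face of an anticlockwise dart of a face is its third vertex.** [folklore] -/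
theorem triLeftApex_faceVertex (w : LatticeModels.HexVertex) (j : Fin 3) :
    triLeftApex (faceVertex w j) (faceVertex w (j + 1)) = faceVertex w (j + 2) := by
  rcases w with ⟨x, t⟩
  by_cases ht : t = 0
  · subst ht
    fin_cases j <;> (ext i; fin_cases i <;> simp [faceVertex, triLeftApex, LatticeModels.triRot60])
  · obtain rfl : t = 1 := by
      rcases Fin.exists_fin_two.1 ⟨t, rfl⟩ with h | h
      · exact (ht h).elim
      · exact h
    fin_cases j <;> (ext i; fin_cases i <;> simp [faceVertex, triLeftApex, LatticeModels.triRot60])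

/-- The face to the left of the dart `u → u + triDir k`, by direction: the up face of the cells
`u, u - e₀, u - e₁` for `k = 0, 2, 4` and the down face of the cells `u - e₀, u - e₀ - e₁, u - e₁`
for `k = 1, 3, 5`. [folklore] -/
def leftFaceDir (u : LatticeModels.Site 2) : Fin 6 → LatticeModels.HexVertex :=
  ![(u, 0), (u - Pi.single 0 1, 1), (u - Pi.single 0 1, 0), (u - Pi.single 0 1 - Pi.single 1 1, 1),
    (u - Pi.single 1 1, 0), (u - Pi.single 1 1, 1)]

/-- **The face to the left of the dart `u → v`** (for adjacent `u, v`; junk otherwise): the face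
with vertices `u, v, triLeftApex u v`. For adjacent `u, v` this is the tree's
`triFace u v (triLeftApex u v) = (triEdgeFaces ⟨(u, v), _⟩).1` (`leftFace_eq_triFace`); the
table `leftFaceDir` is kept for computing with the six directions. [folklore] -/
def leftFace (u v : LatticeModels.Site 2) : LatticeModels.HexVertex := leftFaceDir u (dirOf u v)

/-- At the origin the table `leftFaceDir` is the tree's `triFace` of `0`, `triDir k` and the left
apex (a finite check). [folklore] -/
theorem leftFaceDir_zero_eq_triFace (k : Fin 6) :
    leftFaceDir 0 k = LatticeModels.triFace 0 (triDir k) (triLeftApex 0 (triDir k)) := by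
  revert k; decide

/-- `leftFaceDir` is translation covariant. [folklore] -/
theorem leftFaceDir_eq_add (u : LatticeModels.Site 2) (k : Fin 6) :
    leftFaceDir u k = (u + (leftFaceDir 0 k).1, (leftFaceDir 0 k).2) := by
  fin_cases k <;> simp [leftFaceDir, sub_eq_add_neg, add_assoc]

/-- **The left face of the dart `u → u + triDir k` is the tree's
`triFace u v (triLeftApex u v)`** (`TriangularLattice.lean`; by translation covariance of both,
`triFace_add`). [folklore] -/
theorem leftFaceDir_eq_triFace (u : LatticeModels.Site 2) (k : Fin 6) :
    leftFaceDir u k = LatticeModels.triFace u (u + triDir k) (triLeftApex u (u + triDir k)) := by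
  rw [leftFaceDir_eq_add, leftFaceDir_zero_eq_triFace, triLeftApex_add_triDir]
  have e0 : triLeftApex (0 : LatticeModels.Site 2) (triDir k) = triDir (k + 1) := by
    have := triLeftApex_add_triDir (0 : LatticeModels.Site 2) k
    rwa [zero_add, zero_add] at this
  have e := LatticeModels.triFace_add u 0 (triDir k) (triDir (k + 1))
  rw [add_zero] at e
  rw [e0, e]

/-- **`leftFace u v` is the tree's left face of the dart**: `triFace u v (triLeftApex u v)`, the
first component of `triEdgeFaces ⟨(u, v), h⟩` (definitionally). [folklore] -/
theorem leftFace_eq_triFace {u v : LatticeModels.Site 2} (h : LatticeModels.triGraph.Adj u v) :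
    leftFace u v = LatticeModels.triFace u v (triLeftApex u v) := by
  obtain ⟨k, rfl⟩ := (triGraph_adj_iff_triDir u v).1 h
  rw [leftFace, dirOf_add_triDir, leftFaceDir_eq_triFace]

/-- … i.e. the first component of `triEdgeFaces` of the dart. [folklore] -/
theorem leftFace_eq_triEdgeFaces_fst {u v : LatticeModels.Site 2} (h : LatticeModels.triGraph.Adj u v) :
    leftFace u v = (LatticeModels.triEdgeFaces ⟨(u, v), h⟩).1 :=
  leftFace_eq_triFace h

/-- The index, in its left face, of the tail of a dart of direction `k`. [folklore] -/
def leftFaceIdx : Fin 6 → Fin 3 := ![0, 0, 1, 1, 2, 2]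

/-- The dart `u → u + triDir k` is the `leftFaceIdx k`-th anticlockwise dart of its left face:
its tail is that vertex … [folklore] -/
theorem faceVertex_leftFaceDir (u : LatticeModels.Site 2) (k : Fin 6) :
    faceVertex (leftFaceDir u k) (leftFaceIdx k) = u := by
  fin_cases k <;> (ext i; fin_cases i <;> simp [faceVertex, leftFaceDir, leftFaceIdx])

/-- … and its direction is the corresponding dart direction of that face. [folklore] -/
theorem faceDartDir_leftFaceDir (u : LatticeModels.Site 2) (k : Fin 6) :
    faceDartDir (leftFaceDir u k) (leftFaceIdx k) = k := by
  fin_cases k <;> simp [faceDartDir, leftFaceDir, leftFaceIdx]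

/-- **Every dart is an anticlockwise dart of its left face.** [folklore] -/
theorem exists_eq_faceVertex_of_adj {u v : LatticeModels.Site 2} (h : LatticeModels.triGraph.Adj u v) :
    ∃ j : Fin 3, u = faceVertex (leftFace u v) j ∧ v = faceVertex (leftFace u v) (j + 1) := by
  obtain ⟨k, rfl⟩ := (triGraph_adj_iff_triDir u v).1 h
  refine ⟨leftFaceIdx k, ?_, ?_⟩
  · rw [leftFace, dirOf_add_triDir, faceVertex_leftFaceDir]
  · rw [leftFace, dirOf_add_triDir, faceVertex_succ, faceVertex_leftFaceDir,
      faceDartDir_leftFaceDir]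

/-- **The left face of an anticlockwise dart of a face is that face.** [folklore] -/
theorem leftFace_faceVertex (w : LatticeModels.HexVertex) (j : Fin 3) :
    leftFace (faceVertex w j) (faceVertex w (j + 1)) = w := by
  rw [faceVertex_succ, leftFace, dirOf_add_triDir]
  rcases w with ⟨x, t⟩
  by_cases ht : t = 0
  · subst ht
    fin_cases j <;> simp [faceVertex, faceDartDir, leftFaceDir]
  · obtain rfl : t = 1 := by
      rcases Fin.exists_fin_two.1 ⟨t, rfl⟩ with h | h
      · exact (ht h).elim
      · exact h
    fin_cases j <;> simp [faceVertex, faceDartDir, leftFaceDir]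
    abel

/-- The vertices of the left face of a dart: tail, head and apex. [folklore] -/
theorem hexFaceVertices_leftFace {u v : LatticeModels.Site 2} (h : LatticeModels.triGraph.Adj u v) :
    LatticeModels.hexFaceVertices (leftFace u v) = {u, v, triLeftApex u v} := by
  obtain ⟨j, hu, hv⟩ := exists_eq_faceVertex_of_adj h
  set w := leftFace u v
  rw [hu, hv, triLeftApex_faceVertex, hexFaceVertices_eq_image_faceVertex]
  ext z
  simp only [mem_image, mem_univ, true_and, mem_insert, mem_singleton]
  constructor
  · rintro ⟨i, rfl⟩
    have : i = j ∨ i = j + 1 ∨ i = j + 2 := by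
      fin_cases i <;> fin_cases j <;> simp
    rcases this with rfl | rfl | rfl
    · exact Or.inl rfl
    · exact Or.inr (Or.inl rfl)
    · exact Or.inr (Or.inr rfl)
  · rintro (rfl | rfl | rfl)
    · exact ⟨j, rfl⟩
    · exact ⟨j + 1, rfl⟩
    · exact ⟨j + 2, rfl⟩

/-- The six faces at a site, as (cell offset, type). [folklore] -/
def facesAtOffsets : Finset (LatticeModels.Site 2 × Fin 2) :=
  {(0, 0), (-Pi.single 0 1, 1), (-Pi.single 0 1, 0), (-Pi.single 0 1 - Pi.single 1 1, 1),
    (-Pi.single 1 1, 0), (-Pi.single 1 1, 1)}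

/-- **The six faces of `𝕋` at the site `u`.** [folklore] -/
def facesAt (u : LatticeModels.Site 2) : Finset LatticeModels.HexVertex :=
  facesAtOffsets.image fun ot => (u + ot.1, ot.2)

/-- There are six faces at each site. [folklore] -/
theorem card_facesAt (u : LatticeModels.Site 2) : #(facesAt u) = 6 := by
  rw [facesAt, card_image_of_injective]
  · decide
  · rintro ⟨o, t⟩ ⟨o', t'⟩ h
    simp only [Prod.mk.injEq, add_right_inj] at h
    rw [h.1, h.2]

/-- The faces at `u` are the left faces of the six darts out of `u`. [folklore] -/
theorem facesAt_eq_image_leftFaceDir (u : LatticeModels.Site 2) :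
    facesAt u = univ.image (leftFaceDir u) := by
  ext w
  simp only [facesAt, facesAtOffsets, mem_image, mem_insert, mem_singleton, mem_univ, true_and,
    leftFaceDir]
  constructor
  · rintro ⟨ot, h, rfl⟩
    rcases h with rfl | rfl | rfl | rfl | rfl | rfl
    · exact ⟨0, by simp⟩
    · exact ⟨1, by simp [sub_eq_add_neg]⟩
    · exact ⟨2, by simp [sub_eq_add_neg]⟩
    · exact ⟨3, by simp [sub_eq_add_neg, add_assoc]⟩
    · exact ⟨4, by simp [sub_eq_add_neg]⟩
    · exact ⟨5, by simp [sub_eq_add_neg]⟩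
  · rintro ⟨k, rfl⟩
    fin_cases k
    · exact ⟨(0, 0), Or.inl rfl, by simp⟩
    · exact ⟨(-Pi.single 0 1, 1), by simp, by simp [sub_eq_add_neg]⟩
    · exact ⟨(-Pi.single 0 1, 0), by simp, by simp [sub_eq_add_neg]⟩
    · exact ⟨(-Pi.single 0 1 - Pi.single 1 1, 1), by simp, by simp [sub_eq_add_neg, add_assoc]⟩
    · exact ⟨(-Pi.single 1 1, 0), by simp, by simp [sub_eq_add_neg]⟩
    · exact ⟨(-Pi.single 1 1, 1), by simp, by simp [sub_eq_add_neg]⟩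

/-- **Membership in `facesAt`**: the faces at `u` are the faces having `u` as a vertex. [folklore] -/
theorem mem_facesAt {u : LatticeModels.Site 2} {w : LatticeModels.HexVertex} : w ∈ facesAt u ↔ u ∈ LatticeModels.hexFaceVertices w := by
  rw [facesAt_eq_image_leftFaceDir]
  simp only [mem_image, mem_univ, true_and]
  constructor
  · rintro ⟨k, rfl⟩
    rw [mem_hexFaceVertices_iff_faceVertex]
    exact ⟨leftFaceIdx k, (faceVertex_leftFaceDir u k).symm⟩
  · intro h
    obtain ⟨j, rfl⟩ := mem_hexFaceVertices_iff_faceVertex.1 h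
    refine ⟨dirOf (faceVertex w j) (faceVertex w (j + 1)), ?_⟩
    exact leftFace_faceVertex w j

/-! ### The discrete Gauss–Bonnet formula -/

/-- **The turn of the boundary after the boundary dart `d = (u, v)`**: `+1` (a left turn, around
the hexagon `H_u`, the next boundary dart being `u → w`) if the apex `w` of the left face is
outside `G`, `-1` (a right turn, around `H_v`, next dart `w → v`) if it is inside
(cf. `triBdrySucc`). [folklore] -/
def triTurn (G : Finset (LatticeModels.Site 2)) (d : LatticeModels.Site 2 × LatticeModels.Site 2) : ℤ :=
  if triLeftApex d.1 d.2 ∈ G then -1 else 1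

/-- The faces of `𝕋` having a vertex in `G`. [folklore] -/
def triFacesTouching (G : Finset (LatticeModels.Site 2)) : Finset LatticeModels.HexVertex := G.biUnion facesAt

/-- Membership in `triFacesTouching`. [folklore] -/
theorem mem_triFacesTouching {G : Finset (LatticeModels.Site 2)} {w : LatticeModels.HexVertex} :
    w ∈ triFacesTouching G ↔ ∃ v ∈ G, v ∈ LatticeModels.hexFaceVertices w := by
  simp only [triFacesTouching, mem_biUnion, mem_facesAt]

/-- The number of vertices of the face `w` in `G`. [folklore] -/
def faceDeg (G : Finset (LatticeModels.Site 2)) (w : LatticeModels.HexVertex) : ℕ := #(LatticeModels.hexFaceVertices w ∩ G)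

/-- A face has at most three vertices in `G`. [folklore] -/
theorem faceDeg_le (G : Finset (LatticeModels.Site 2)) (w : LatticeModels.HexVertex) : faceDeg G w ≤ 3 := by
  rw [faceDeg, ← card_hexFaceVertices w]
  exact card_le_card inter_subset_left

/-- A face touching `G` has a vertex in `G`. [folklore] -/
theorem one_le_faceDeg {G : Finset (LatticeModels.Site 2)} {w : LatticeModels.HexVertex} (h : w ∈ triFacesTouching G) :
    1 ≤ faceDeg G w := by
  obtain ⟨v, hv, hvw⟩ := mem_triFacesTouching.1 h
  exact card_pos.2 ⟨v, mem_inter.2 ⟨hvw, hv⟩⟩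

/-- `faceDeg = 3` iff the face lies inside `G`. [folklore] -/
theorem faceDeg_eq_three_iff {G : Finset (LatticeModels.Site 2)} {w : LatticeModels.HexVertex} :
    faceDeg G w = 3 ↔ LatticeModels.hexFaceVertices w ⊆ G := by
  rw [faceDeg, ← inter_eq_left, ← card_hexFaceVertices w]
  constructor
  · intro h
    exact eq_of_subset_of_card_le inter_subset_left h.ge
  · intro h; rw [h]

/-- **`6 V = Σ_faces (vertices in G)`**: every site lies on six faces. [folklore] -/
theorem six_mul_card_eq_sum_faceDeg (G : Finset (LatticeModels.Site 2)) :
    6 * #G = ∑ w ∈ triFacesTouching G, faceDeg G w := by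
  classical
  have h := sum_card_bipartiteAbove_eq_sum_card_bipartiteBelow (s := G) (t := triFacesTouching G)
    (r := fun v w => v ∈ LatticeModels.hexFaceVertices w)
  have hl : ∀ v ∈ G, #((triFacesTouching G).bipartiteAbove (fun v w => v ∈ LatticeModels.hexFaceVertices w) v)
      = 6 := by
    intro v hv
    rw [← card_facesAt v]
    congr 1
    ext w
    rw [mem_bipartiteAbove, mem_facesAt, mem_triFacesTouching]
    exact ⟨fun h => h.2, fun h => ⟨⟨v, hv, h⟩, h⟩⟩
  have hr : ∀ w ∈ triFacesTouching G,
      #(G.bipartiteBelow (fun v w => v ∈ LatticeModels.hexFaceVertices w) w) = faceDeg G w := by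
    intro w _
    rw [faceDeg]
    congr 1
    ext v
    rw [mem_bipartiteBelow, mem_inter, and_comm]
  rw [sum_congr rfl hl, sum_congr rfl hr, sum_const, smul_eq_mul, mul_comm] at h
  exact h

/-- The two vertices of an anticlockwise dart of a face determine the position: if
`faceVertex w i = faceVertex w j'` … (index bookkeeping). [folklore] -/
theorem leftFace_ne_leftFace_symm {a b : LatticeModels.Site 2} (h : LatticeModels.triGraph.Adj a b) :
    leftFace a b ≠ leftFace b a := by
  intro he
  obtain ⟨j, hj, hj1⟩ := exists_eq_faceVertex_of_adj h
  obtain ⟨j', hj', hj1'⟩ := exists_eq_faceVertex_of_adj h.symm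
  rw [← he] at hj' hj1'
  have e1 : j = j' + 1 := faceVertex_injective _ (hj.symm.trans hj1')
  have e2 : j + 1 = j' := faceVertex_injective _ (hj1.symm.trans hj')
  rw [e1] at e2
  revert e2; fin_cases j' <;> decide

/-- **The faces containing an edge are its two bordering faces.** [folklore] -/
theorem filter_mem_mem_eq_pair {G : Finset (LatticeModels.Site 2)} {a b : LatticeModels.Site 2} (ha : a ∈ G)
    (h : LatticeModels.triGraph.Adj a b) :
    (triFacesTouching G).filter (fun w => a ∈ LatticeModels.hexFaceVertices w ∧ b ∈ LatticeModels.hexFaceVertices w) =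
      {leftFace a b, leftFace b a} := by
  ext w
  simp only [mem_filter, mem_triFacesTouching, mem_insert, mem_singleton]
  constructor
  · rintro ⟨-, haw, hbw⟩
    obtain ⟨i, rfl⟩ := mem_hexFaceVertices_iff_faceVertex.1 haw
    obtain ⟨i', rfl⟩ := mem_hexFaceVertices_iff_faceVertex.1 hbw
    have hii' : i' = i + 1 ∨ i = i' + 1 := by
      have hne : i ≠ i' := fun e => h.ne (by rw [e])
      revert hne; fin_cases i <;> fin_cases i' <;> decide
    rcases hii' with rfl | rfl
    · exact Or.inl (leftFace_faceVertex w i).symm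
    · exact Or.inr (leftFace_faceVertex w i').symm
  · rintro (rfl | rfl)
    · refine ⟨⟨a, ha, ?_⟩, ?_, ?_⟩ <;> simp [hexFaceVertices_leftFace h]
    · refine ⟨⟨a, ha, ?_⟩, ?_, ?_⟩ <;> simp [hexFaceVertices_leftFace h.symm]

/-- The vertices of a face are pairwise adjacent. [folklore] -/
theorem adj_of_mem_hexFaceVertices {w : LatticeModels.HexVertex} {a b : LatticeModels.Site 2} (ha : a ∈ LatticeModels.hexFaceVertices w)
    (hb : b ∈ LatticeModels.hexFaceVertices w) (hab : a ≠ b) : LatticeModels.triGraph.Adj a b := by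
  obtain ⟨i, rfl⟩ := mem_hexFaceVertices_iff_faceVertex.1 ha
  obtain ⟨i', rfl⟩ := mem_hexFaceVertices_iff_faceVertex.1 hb
  have hii' : i' = i + 1 ∨ i = i' + 1 := by
    have hne : i ≠ i' := fun e => hab (by rw [e])
    revert hne; fin_cases i <;> fin_cases i' <;> decide
  rcases hii' with rfl | rfl
  · rw [faceVertex_succ]; exact triGraph_adj_add_triDir _ _
  · rw [faceVertex_succ]; exact (triGraph_adj_add_triDir _ _).symm

/-- **`2 · (2E) = Σ_faces n (n - 1)`**: every edge borders two faces, and the ordered pairs of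
distinct vertices of a face in `G` are `n (n - 1)` adjacent pairs. [folklore] -/
theorem two_mul_card_triAdjPairs_eq_sum (G : Finset (LatticeModels.Site 2)) :
    2 * #(triAdjPairs G) = ∑ w ∈ triFacesTouching G, faceDeg G w * (faceDeg G w - 1) := by
  classical
  have h := sum_card_bipartiteAbove_eq_sum_card_bipartiteBelow (s := triAdjPairs G)
    (t := triFacesTouching G) (r := fun p w => p.1 ∈ LatticeModels.hexFaceVertices w ∧ p.2 ∈ LatticeModels.hexFaceVertices w)
  have hl : ∀ p ∈ triAdjPairs G, #((triFacesTouching G).bipartiteAbove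
      (fun p w => p.1 ∈ LatticeModels.hexFaceVertices w ∧ p.2 ∈ LatticeModels.hexFaceVertices w) p) = 2 := by
    rintro ⟨a, b⟩ hp
    obtain ⟨ha, -, hab⟩ := mem_triAdjPairs.1 hp
    rw [bipartiteAbove, filter_mem_mem_eq_pair ha hab, card_pair (leftFace_ne_leftFace_symm hab)]
  have hr : ∀ w ∈ triFacesTouching G, #((triAdjPairs G).bipartiteBelow
      (fun p w => p.1 ∈ LatticeModels.hexFaceVertices w ∧ p.2 ∈ LatticeModels.hexFaceVertices w) w) =
        faceDeg G w * (faceDeg G w - 1) := by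
    intro w _
    rw [faceDeg, Nat.mul_sub_one, ← offDiag_card]
    congr 1
    ext ⟨a, b⟩
    simp only [mem_bipartiteBelow, mem_triAdjPairs, mem_offDiag, mem_inter]
    constructor
    · rintro ⟨⟨ha, hb, hab⟩, haw, hbw⟩
      exact ⟨⟨haw, ha⟩, ⟨hbw, hb⟩, hab.ne⟩
    · rintro ⟨⟨haw, ha⟩, ⟨hbw, hb⟩, hab⟩
      exact ⟨⟨ha, hb, adj_of_mem_hexFaceVertices haw hbw hab⟩, haw, hbw⟩
  rw [sum_congr rfl hl, sum_congr rfl hr, sum_const, smul_eq_mul, mul_comm] at h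
  exact h

/-- **`F = #{faces with all three vertices in G}`** among the touching faces. [folklore] -/
theorem card_triFacesIn_eq_sum (G : Finset (LatticeModels.Site 2)) :
    #(triFacesIn G) = ∑ w ∈ triFacesTouching G, if faceDeg G w = 3 then 1 else 0 := by
  rw [sum_boole, Nat.cast_id]
  congr 1
  ext w
  rw [mem_triFacesIn, mem_filter, faceDeg_eq_three_iff, mem_triFacesTouching]
  constructor
  · intro h
    refine ⟨⟨faceVertex w 0, h (faceVertex_mem w 0), faceVertex_mem w 0⟩, h⟩
  · exact fun h => h.2

/-- **The Euler characteristic by faces**: `6 · (2χ) = Σ_faces (2 [n = 1] - 2 [n = 2])` over the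
faces touching `G`, `n` the number of vertices in `G`. [folklore] -/
theorem six_mul_triEulerTwice (G : Finset (LatticeModels.Site 2)) :
    6 * triEulerTwice G = ∑ w ∈ triFacesTouching G,
      ((if faceDeg G w = 1 then 2 else 0) - (if faceDeg G w = 2 then 2 else 0) : ℤ) := by
  have h1 := six_mul_card_eq_sum_faceDeg G
  have h2 := two_mul_card_triAdjPairs_eq_sum G
  have h3 := card_triFacesIn_eq_sum G
  have e : 6 * triEulerTwice G = 2 * ((6 * #G : ℕ) : ℤ) - 3 * ((2 * #(triAdjPairs G) : ℕ) : ℤ) +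
      12 * ((#(triFacesIn G) : ℕ) : ℤ) := by
    unfold triEulerTwice; push_cast; ring
  rw [e, h1, h2, h3]
  push_cast
  rw [mul_sum, mul_sum, mul_sum, ← sum_sub_distrib, ← sum_add_distrib]
  refine sum_congr rfl fun w hw => ?_
  have hle := faceDeg_le G w
  have hge := one_le_faceDeg hw
  interval_cases (faceDeg G w) <;> simp

/-- The left face of a boundary dart touches `G`. [folklore] -/
theorem leftFace_mem_triFacesTouching {G : Finset (LatticeModels.Site 2)} {d : LatticeModels.Site 2 × LatticeModels.Site 2}
    (hd : d ∈ triBdryDarts G) : leftFace d.1 d.2 ∈ triFacesTouching G := by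
  obtain ⟨hu, -, hadj⟩ := mem_triBdryDarts.1 hd
  exact mem_triFacesTouching.2 ⟨d.1, hu, by simp [hexFaceVertices_leftFace hadj]⟩

/-- The apex of the left face differs from tail and head. [folklore] -/
theorem triLeftApex_ne {u v : LatticeModels.Site 2} (h : LatticeModels.triGraph.Adj u v) :
    triLeftApex u v ≠ u ∧ triLeftApex u v ≠ v := by
  obtain ⟨k, rfl⟩ := (triGraph_adj_iff_triDir u v).1 h
  rw [triLeftApex_add_triDir]
  refine ⟨fun e => triDir_ne_zero (k + 1) (by simpa using e), fun e => ?_⟩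
  have := triDir_injective (add_left_cancel e)
  revert this; fin_cases k <;> decide

/-- **The number of `G`-vertices of the left face of a boundary dart**: `1` after a left turn,
`2` after a right turn. [folklore] -/
theorem faceDeg_leftFace {G : Finset (LatticeModels.Site 2)} {d : LatticeModels.Site 2 × LatticeModels.Site 2} (hd : d ∈ triBdryDarts G) :
    faceDeg G (leftFace d.1 d.2) = if triLeftApex d.1 d.2 ∈ G then 2 else 1 := by
  obtain ⟨hu, hv, hadj⟩ := mem_triBdryDarts.1 hd
  obtain ⟨hwu, hwv⟩ := triLeftApex_ne hadj
  rw [faceDeg, hexFaceVertices_leftFace hadj]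
  split_ifs with hw
  · rw [show ({d.1, d.2, triLeftApex d.1 d.2} : Finset (LatticeModels.Site 2)) ∩ G = {d.1, triLeftApex d.1 d.2} by
      ext z; simp only [mem_inter, mem_insert, mem_singleton]
      constructor
      · rintro ⟨rfl | rfl | rfl, hz⟩
        · exact Or.inl rfl
        · exact (hv hz).elim
        · exact Or.inr rfl
      · rintro (rfl | rfl)
        · exact ⟨Or.inl rfl, hu⟩
        · exact ⟨Or.inr (Or.inr rfl), hw⟩]
    exact card_pair hwu.symm
  · rw [show ({d.1, d.2, triLeftApex d.1 d.2} : Finset (LatticeModels.Site 2)) ∩ G = {d.1} by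
      ext z; simp only [mem_inter, mem_insert, mem_singleton]
      constructor
      · rintro ⟨rfl | rfl | rfl, hz⟩
        · rfl
        · exact (hv hz).elim
        · exact (hw hz).elim
      · rintro rfl; exact ⟨Or.inl rfl, hu⟩]
    exact card_singleton _

/-- The turn indicator of a boundary dart as the number of `G`-vertices of its left face. [folklore] -/
def turnDeg (G : Finset (LatticeModels.Site 2)) (d : LatticeModels.Site 2 × LatticeModels.Site 2) : ℕ :=
  if triLeftApex d.1 d.2 ∈ G then 2 else 1

/-- **The left faces of the boundary darts with a given turn are exactly the touching faces
with the corresponding number (`1` or `2`) of vertices in `G`** (a bijection). [folklore] -/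
theorem card_filter_turnDeg_eq (G : Finset (LatticeModels.Site 2)) {c : ℕ} (hc : c = 1 ∨ c = 2) :
    #((triBdryDarts G).filter fun d => turnDeg G d = c) =
      #((triFacesTouching G).filter fun w => faceDeg G w = c) := by
  refine card_bij (fun d _ => leftFace d.1 d.2) (fun d hd => ?_) (fun d hd d' hd' he => ?_)
    (fun w hw => ?_)
  · -- maps into
    obtain ⟨hd, hb⟩ := mem_filter.1 hd
    refine mem_filter.2 ⟨leftFace_mem_triFacesTouching hd, ?_⟩
    rw [faceDeg_leftFace hd, ← hb, turnDeg]
  · -- injective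
    obtain ⟨hd, -⟩ := mem_filter.1 hd
    obtain ⟨hd', -⟩ := mem_filter.1 hd'
    obtain ⟨hu, hv, hadj⟩ := mem_triBdryDarts.1 hd
    obtain ⟨hu', hv', hadj'⟩ := mem_triBdryDarts.1 hd'
    obtain ⟨j, hj, hj1⟩ := exists_eq_faceVertex_of_adj hadj
    obtain ⟨j', hj', hj1'⟩ := exists_eq_faceVertex_of_adj hadj'
    set w := leftFace d.1 d.2 with hw_def
    rw [← he] at hj' hj1'
    have key : j = j' := by
      by_contra hne
      have hc : j' = j + 1 ∨ j' = j + 2 := by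
        revert hne; fin_cases j <;> fin_cases j' <;> decide
      rcases hc with rfl | rfl
      · exact hv (hj1 ▸ hj' ▸ hu')
      · have e3 : j + 2 + 1 = j := by
          have : (2 : Fin 3) + 1 = 0 := by decide
          rw [add_assoc, this, add_zero]
        rw [e3] at hj1'
        exact hv' (hj1' ▸ hj ▸ hu)
    subst key
    exact Prod.ext (hj.trans hj'.symm) (hj1.trans hj1'.symm)
  · -- surjective
    obtain ⟨hw, hdeg⟩ := mem_filter.1 hw
    obtain ⟨v, hvG, hvw⟩ := mem_triFacesTouching.1 hw
    obtain ⟨i, rfl⟩ := mem_hexFaceVertices_iff_faceVertex.1 hvw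
    have hex : ∃ j, faceVertex w j ∈ G ∧ faceVertex w (j + 1) ∉ G := by
      by_contra hno
      push Not at hno
      have h1 := hno i hvG
      have h2 := hno (i + 1) h1
      have hall : LatticeModels.hexFaceVertices w ⊆ G := by
        intro z hz
        obtain ⟨j, rfl⟩ := mem_hexFaceVertices_iff_faceVertex.1 hz
        have : j = i ∨ j = i + 1 ∨ j = i + 1 + 1 := by
          fin_cases i <;> fin_cases j <;> decide
        rcases this with rfl | rfl | rfl <;> assumption
      have h3 := faceDeg_eq_three_iff.2 hall
      rw [h3] at hdeg
      rcases hc with rfl | rfl <;> simp at hdeg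
    obtain ⟨j, hj, hj1⟩ := hex
    have hadj : LatticeModels.triGraph.Adj (faceVertex w j) (faceVertex w (j + 1)) := by
      rw [faceVertex_succ]; exact triGraph_adj_add_triDir _ _
    have hd : (faceVertex w j, faceVertex w (j + 1)) ∈ triBdryDarts G :=
      mem_triBdryDarts.2 ⟨hj, hj1, hadj⟩
    refine ⟨(faceVertex w j, faceVertex w (j + 1)), mem_filter.2 ⟨hd, ?_⟩, leftFace_faceVertex w j⟩
    have hdeg' := faceDeg_leftFace hd
    simp only [leftFace_faceVertex] at hdeg'
    rw [turnDeg, ← hdeg', hdeg]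

/-- **Discrete Gauss–Bonnet formula**: the total turn of the boundary of `⋃_{v ∈ G} H_v` is
`6 χ = 3 · triEulerTwice G`. [folklore] -/
theorem sum_triTurn_eq (G : Finset (LatticeModels.Site 2)) :
    ∑ d ∈ triBdryDarts G, triTurn G d = 3 * triEulerTwice G := by
  have hsplit : ∑ d ∈ triBdryDarts G, triTurn G d =
      (#((triBdryDarts G).filter fun d => turnDeg G d = 1) : ℤ) -
        #((triBdryDarts G).filter fun d => turnDeg G d = 2) := by
    rw [natCast_card_filter, natCast_card_filter, ← sum_sub_distrib]
    refine sum_congr rfl fun d _ => ?_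
    unfold triTurn turnDeg
    by_cases h : triLeftApex d.1 d.2 ∈ G <;> simp [h]
  have h6 := six_mul_triEulerTwice G
  rw [hsplit, card_filter_turnDeg_eq G (Or.inl rfl), card_filter_turnDeg_eq G (Or.inr rfl),
    natCast_card_filter, natCast_card_filter]
  have e : ∑ w ∈ triFacesTouching G,
      ((if faceDeg G w = 1 then 2 else 0) - (if faceDeg G w = 2 then 2 else 0) : ℤ) =
      2 * (∑ w ∈ triFacesTouching G, if faceDeg G w = 1 then (1 : ℤ) else 0) -
        2 * ∑ w ∈ triFacesTouching G, if faceDeg G w = 2 then (1 : ℤ) else 0 := by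
    simp only [Finset.mul_sum, ← Finset.sum_sub_distrib]
    refine sum_congr rfl fun w _ => ?_
    split_ifs <;> norm_num
  linarith

/-! ### Discs: a single boundary cycle and Euler characteristic one -/

/-- **A disc of hexagons with a base dart**: the boundary darts of `G` form a single cycle under
the anticlockwise successor, traversed from the boundary dart `b` in `#∂G` steps, and the Euler
characteristic of the hexagon nerve is `1` ("the union of the closed hexagons is simply
connected … its topological boundary `∂G` is a simple cycle in the hexagonal lattice",
Bollobás–Riordan 2006, p. 168) — the part of `TriMarkedDomain` used by the shelling.
[cite: BollobasRiordan2006, Ch. 7 §7.2.2 p. 168] -/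
structure IsTriDisc (G : Finset (LatticeModels.Site 2)) (b : LatticeModels.Site 2 × LatticeModels.Site 2) : Prop where
  /-- The base is a boundary dart. -/
  base_mem : b ∈ triBdryDarts G
  /-- Every boundary dart is visited from the base within `#∂G` steps … -/
  cycle : ∀ d ∈ triBdryDarts G, ∃ n < #(triBdryDarts G), triBdryIter G b n = d
  /-- … and the traversal closes up after `#∂G` steps. -/
  cycle_len : triBdryIter G b #(triBdryDarts G) = b
  /-- Euler characteristic `1`. -/
  euler : triEulerTwice G = 2

/-- A marked discrete domain is a disc based at its base dart. [folklore] -/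
theorem TriMarkedDomain.isTriDisc {k : ℕ} (D : TriMarkedDomain k) : IsTriDisc D.verts D.base :=
  ⟨D.base_mem, D.cycle, D.cycle_len, D.euler⟩

/-- Iterating the successor is additive. [folklore] -/
theorem triBdryIter_add (G : Finset (LatticeModels.Site 2)) (d : LatticeModels.Site 2 × LatticeModels.Site 2) (m n : ℕ) :
    triBdryIter G d (m + n) = triBdryIter G (triBdryIter G d m) n := by
  rw [triBdryIter, triBdryIter, triBdryIter, add_comm, Function.iterate_add_apply]

namespace IsTriDisc

variable {G : Finset (LatticeModels.Site 2)} {b : LatticeModels.Site 2 × LatticeModels.Site 2} (h : IsTriDisc G b)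
include h

/-- The boundary of a disc is nonempty. [folklore] -/
theorem card_pos : 0 < #(triBdryDarts G) := Finset.card_pos.2 ⟨b, h.base_mem⟩

/-- The traversal is periodic with period `#∂G`. [folklore] -/
theorem iter_add_card (n : ℕ) : triBdryIter G b (n + #(triBdryDarts G)) = triBdryIter G b n := by
  rw [add_comm, triBdryIter_add, h.cycle_len]

/-- The traversal only depends on the position modulo `#∂G`. [folklore] -/
theorem iter_mod (n : ℕ) : triBdryIter G b (n % #(triBdryDarts G)) = triBdryIter G b n := by
  conv_rhs => rw [← Nat.mod_add_div n #(triBdryDarts G)]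
  generalize n / #(triBdryDarts G) = q
  induction q with
  | zero => simp
  | succ q ih => rw [Nat.mul_succ, ← add_assoc, h.iter_add_card, ih]

/-- The first `#∂G` darts of the traversal are all the boundary darts. [folklore] -/
theorem image_range : (range #(triBdryDarts G)).image (triBdryIter G b) = triBdryDarts G := by
  apply Subset.antisymm
  · intro d hd
    obtain ⟨n, -, rfl⟩ := mem_image.1 hd
    exact triBdryIter_mem h.base_mem n
  · intro d hd
    obtain ⟨n, hn, rfl⟩ := h.cycle d hd
    exact mem_image.2 ⟨n, mem_range.2 hn, rfl⟩

/-- **The traversal is injective on a period.** [folklore] -/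
theorem injOn : Set.InjOn (triBdryIter G b) (range #(triBdryDarts G) : Finset ℕ) := by
  have := card_image_iff.1 (by rw [h.image_range, card_range])
  exact this

/-- Two positions carry the same dart iff they agree modulo `#∂G`. [folklore] -/
theorem iter_eq_iter_iff {m n : ℕ} :
    triBdryIter G b m = triBdryIter G b n ↔ m % #(triBdryDarts G) = n % #(triBdryDarts G) := by
  constructor
  · intro hmn
    rw [← h.iter_mod m, ← h.iter_mod n] at hmn
    exact h.injOn (mem_coe.2 (mem_range.2 (Nat.mod_lt _ h.card_pos)))
      (mem_coe.2 (mem_range.2 (Nat.mod_lt _ h.card_pos))) hmn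
  · intro hmn
    rw [← h.iter_mod m, hmn, h.iter_mod]

/-- **Rebasing**: a disc may be traversed from any of its boundary darts. [folklore] -/
theorem rebase {d : LatticeModels.Site 2 × LatticeModels.Site 2} (hd : d ∈ triBdryDarts G) : IsTriDisc G d := by
  obtain ⟨n₀, hn₀, rfl⟩ := h.cycle d hd
  refine ⟨hd, fun d' hd' => ?_, ?_, h.euler⟩
  · obtain ⟨n', hn', rfl⟩ := h.cycle d' hd'
    refine ⟨(n' + (#(triBdryDarts G) - n₀)) % #(triBdryDarts G), Nat.mod_lt _ h.card_pos, ?_⟩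
    rw [← triBdryIter_add, ← h.iter_mod, Nat.add_mod_mod]
    have e : n₀ + (n' + (#(triBdryDarts G) - n₀)) = n' + #(triBdryDarts G) := by omega
    rw [e, h.iter_mod, h.iter_add_card]
  · rw [← triBdryIter_add, h.iter_add_card]

/-- The total turn over one traversal of the boundary of a disc is `+6` (one full turn). [folklore] -/
theorem sum_triTurn_range : ∑ n ∈ range #(triBdryDarts G), triTurn G (triBdryIter G b n) = 6 := by
  rw [← sum_image fun m hm n hn hmn => h.injOn hm hn hmn, h.image_range, sum_triTurn_eq, h.euler]
  norm_num

end IsTriDisc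

/-! ### The turn at a site: a removable boundary hexagon exists -/

/-- The boundary darts out of the site `u`: `u → u + triDir j` for the outside directions `j`. [folklore] -/
theorem filter_fst_eq (G : Finset (LatticeModels.Site 2)) {u : LatticeModels.Site 2} (hu : u ∈ G) :
    (triBdryDarts G).filter (fun d => d.1 = u) =
      (univ.filter fun j => u + triDir j ∉ G).image fun j => (u, u + triDir j) := by
  ext ⟨x, y⟩
  simp only [mem_filter, mem_triBdryDarts, mem_image, mem_univ, true_and, Prod.mk.injEq]
  constructor
  · rintro ⟨⟨hx, hy, hadj⟩, rfl⟩
    obtain ⟨j, rfl⟩ := (triGraph_adj_iff_triDir x y).1 hadj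
    exact ⟨j, hy, rfl, rfl⟩
  · rintro ⟨j, hj, rfl, rfl⟩
    exact ⟨⟨hu, hj, triGraph_adj_add_triDir u j⟩, rfl⟩

/-- **The turn score of an outside-pattern** `f : Fin 6 → Bool` (`f j` = "the neighbour in
direction `j` is outside"): `Σ_{j : f j} (if f (j + 1) then 1 else -1)`, the total turn of the
boundary darts out of a site with this pattern. [folklore] -/
def patternScore (f : Fin 6 → Bool) : ℤ :=
  ∑ j ∈ univ.filter fun j => f j = true, if f (j + 1) = true then (1 : ℤ) else -1

/-- The total turn of the boundary darts out of `u` is the score of its outside-pattern. [folklore] -/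
theorem sum_triTurn_filter_fst (G : Finset (LatticeModels.Site 2)) {u : LatticeModels.Site 2} (hu : u ∈ G) :
    ∑ d ∈ (triBdryDarts G).filter (fun d => d.1 = u), triTurn G d =
      patternScore fun j => decide (u + triDir j ∉ G) := by
  rw [filter_fst_eq G hu, sum_image]
  · unfold patternScore
    have hf : (univ.filter fun j : Fin 6 => u + triDir j ∉ G) =
        univ.filter fun j => decide (u + triDir j ∉ G) = true := by
      ext j; simp
    rw [hf]
    refine sum_congr rfl fun j _ => ?_
    simp only [triTurn, triLeftApex_add_triDir, decide_eq_true_eq]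
    by_cases hj : u + triDir (j + 1) ∈ G <;> simp [hj]
  · intro i _ j _ hij
    simp only [Prod.mk.injEq, add_right_inj, true_and] at hij
    exact triDir_injective hij

/-- **A single block of outside neighbours**: the outside directions of the pattern `f` are
`a, a + 1, …, a + m - 1` for some `a` and `3 ≤ m ≤ 5`. [folklore] -/
def IsOuterBlock (f : Fin 6 → Bool) (a : Fin 6) (m : ℕ) : Prop :=
  3 ≤ m ∧ m ≤ 5 ∧ ∀ t : Fin 6, f (a + t) = decide (t.val < m)

/-- **Positive score forces a single block of `3, 4` or `5` outside neighbours** (a finite check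
over the `64` patterns): apart from the isolated pattern. [folklore] -/
theorem exists_isOuterBlock_of_patternScore_pos (f : Fin 6 → Bool) (hf : 0 < patternScore f)
    (hne : f ≠ fun _ => true) : ∃ a : Fin 6, ∃ m : Fin 6, IsOuterBlock f a m.val := by
  unfold IsOuterBlock
  revert f
  decide

/-- **Existence of a removable boundary hexagon.** In a disc with at least two hexagons some site
has its outside neighbours in a single block of `3, 4` or `5` consecutive directions (by the
Gauss–Bonnet count `Σ turns = 6 = Σ_sites score`, a site of positive score exists, and a
positive score means a single block; the isolated pattern would make the boundary cycle the
hexagon around that site only). [folklore] -/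
theorem IsTriDisc.exists_isOuterBlock {G : Finset (LatticeModels.Site 2)} {b : LatticeModels.Site 2 × LatticeModels.Site 2}
    (h : IsTriDisc G b) (h2 : 2 ≤ #G) :
    ∃ u ∈ G, ∃ a : Fin 6, ∃ m : ℕ, IsOuterBlock (fun j => decide (u + triDir j ∉ G)) a m := by
  classical
  -- Σ_d τ = Σ_{u ∈ G} score(u)
  have hsum : ∑ d ∈ triBdryDarts G, triTurn G d =
      ∑ u ∈ G, patternScore fun j => decide (u + triDir j ∉ G) := by
    rw [← sum_fiberwise_of_maps_to (g := Prod.fst) (t := G)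
      (fun d hd => (mem_triBdryDarts.1 hd).1)]
    exact sum_congr rfl fun u hu => sum_triTurn_filter_fst G hu
  have h6 : ∑ d ∈ triBdryDarts G, triTurn G d = 6 := by
    rw [sum_triTurn_eq, h.euler]; norm_num
  obtain ⟨u, hu, hpos⟩ : ∃ u ∈ G, 0 < patternScore fun j => decide (u + triDir j ∉ G) := by
    by_contra hno
    push Not at hno
    have := sum_nonpos hno
    rw [← hsum, h6] at this
    norm_num at this
  refine ⟨u, hu, ?_⟩
  have hne : (fun j => decide (u + triDir j ∉ G)) ≠ fun _ => true := by
    intro hall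
    -- all six neighbours outside: the orbit of `(u, u + triDir 0)` stays among the darts out of
    -- `u`, but some other site has a boundary dart
    have hout : ∀ j, u + triDir j ∉ G := fun j => by
      have := congrFun hall j; simpa using this
    have hd0 : (u, u + triDir 0) ∈ triBdryDarts G :=
      mem_triBdryDarts.2 ⟨hu, hout 0, triGraph_adj_add_triDir u 0⟩
    have h' := h.rebase hd0
    have hstay : ∀ n, (triBdryIter G (u, u + triDir 0) n).1 = u := by
      intro n
      induction n with
      | zero => rfl
      | succ n ih =>
        rw [triBdryIter_succ]
        set d := triBdryIter G (u, u + triDir 0) n with hd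
        have hdm : d ∈ triBdryDarts G := triBdryIter_mem hd0 n
        obtain ⟨-, -, hadj⟩ := mem_triBdryDarts.1 hdm
        obtain ⟨j, hj⟩ := (triGraph_adj_iff_triDir d.1 d.2).1 hadj
        have hapex : triLeftApex d.1 d.2 ∉ G := by
          rw [hj, ih, triLeftApex_add_triDir]; exact hout _
        rw [triBdrySucc, if_neg hapex]; exact ih
    -- another site with a boundary dart: a site of `G` other than `u`, walk to the boundary
    obtain ⟨v, hv, hvu⟩ : ∃ v ∈ G, v ≠ u := by
      by_contra hno
      push Not at hno
      have : G ⊆ {u} := fun v hv => mem_singleton.2 (hno v hv)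
      have := card_le_card this
      rw [card_singleton] at this
      omega
    -- the site of `G.erase u` with maximal first coordinate gives a boundary dart with tail `≠ u`
    obtain ⟨w, hw, hmax⟩ := exists_max_image (G.erase u) (fun x => x 0) ⟨v, mem_erase.2 ⟨hvu, hv⟩⟩
    have hwG : w ∈ G := (mem_erase.1 hw).2
    have hwu : w ≠ u := (mem_erase.1 hw).1
    have hw0 : w + triDir 0 ∉ G := by
      intro hin
      by_cases hwu' : w + triDir 0 = u
      · have h03 : triDir 3 = -triDir 0 := by simpa using triDir_add_three 0
        exact hout 3 (by rw [← hwu', add_assoc, h03, add_neg_cancel, add_zero]; exact hwG)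
      · have := hmax (w + triDir 0) (mem_erase.2 ⟨hwu', hin⟩)
        simp [triDir] at this
    have hdw : (w, w + triDir 0) ∈ triBdryDarts G :=
      mem_triBdryDarts.2 ⟨hwG, hw0, triGraph_adj_add_triDir w 0⟩
    obtain ⟨n, -, hn⟩ := h'.cycle _ hdw
    have := hstay n
    rw [hn] at this
    exact hwu this
  obtain ⟨a, m, hblock⟩ := exists_isOuterBlock_of_patternScore_pos _ hpos hne
  exact ⟨a, m.val, hblock⟩

/-! ### Removing a boundary hexagon: the local data -/

/-- Consecutive neighbours of a site are adjacent. [folklore] -/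
theorem triGraph_adj_consec (u : LatticeModels.Site 2) (j : Fin 6) :
    LatticeModels.triGraph.Adj (u + triDir j) (u + triDir (j + 1)) := by
  have e : u + triDir (j + 1) = u + triDir j + triDir (j + 2) := by
    rw [add_assoc, triDir_add_triDir_add_two]
  rw [e]; exact triGraph_adj_add_triDir _ _

/-- The left apex of the dart between consecutive neighbours of `u` (anticlockwise) is `u`. [folklore] -/
theorem triLeftApex_consec (u : LatticeModels.Site 2) (j : Fin 6) :
    triLeftApex (u + triDir j) (u + triDir (j + 1)) = u := by
  have e : u + triDir (j + 1) = u + triDir j + triDir (j + 2) := by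
    rw [add_assoc, triDir_add_triDir_add_two]
  rw [e, triLeftApex_add_triDir, add_assoc u, add_assoc j, show (2 : Fin 6) + 1 = 3 by decide,
    triDir_add_three, add_neg_cancel, add_zero]

/-- A neighbour is not the site itself. [folklore] -/
theorem add_triDir_ne (u : LatticeModels.Site 2) (j : Fin 6) : u + triDir j ≠ u := fun e =>
  triDir_ne_zero j (by simpa using e)

/-- **A removable boundary hexagon**: `u ∈ G` whose outside neighbours are exactly those in the
`m` consecutive directions `a, a + 1, …, a + m - 1` (`1 ≤ m ≤ 5`), the neighbours in the
directions `a + m, …, a + 5` lying in `G`. [folklore] -/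
structure RemovableAt (G : Finset (LatticeModels.Site 2)) (u : LatticeModels.Site 2) (a m : Fin 6) : Prop where
  /-- `u` is a site of `G`. -/
  mem : u ∈ G
  /-- At least one outside neighbour (and, as `m ≤ 5`, at least one neighbour inside). -/
  one_le : 1 ≤ m.val
  /-- The outside neighbours form the block. -/
  out_iff : ∀ t : Fin 6, u + triDir (a + t) ∉ G ↔ t.val < m.val

/-- A single block of `3, 4` or `5` outside neighbours is removable. [folklore] -/
theorem RemovableAt.of_isOuterBlock {G : Finset (LatticeModels.Site 2)} {u : LatticeModels.Site 2} (hu : u ∈ G) {a : Fin 6}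
    {m : ℕ} (h : IsOuterBlock (fun j => decide (u + triDir j ∉ G)) a m) :
    RemovableAt G u a ⟨m, by have := h.2.1; omega⟩ := by
  refine ⟨hu, by have := h.1; simp only; omega, fun t => ?_⟩
  have := h.2.2 t
  simp only at this
  exact decide_eq_decide.1 this

namespace RemovableAt

/-- **The darts out of `u`** (the block), by offset. [folklore] -/
def blk (u : LatticeModels.Site 2) (a t : Fin 6) : LatticeModels.Site 2 × LatticeModels.Site 2 := (u, u + triDir (a + t))

/-- **The new boundary darts into `u`** after its removal, by offset. [folklore] -/
def nw (u : LatticeModels.Site 2) (a t : Fin 6) : LatticeModels.Site 2 × LatticeModels.Site 2 := (u + triDir (a + t), u)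

/-- The boundary dart before the block: from the last inside neighbour to the first outside one. [folklore] -/
def dMinus (u : LatticeModels.Site 2) (a : Fin 6) : LatticeModels.Site 2 × LatticeModels.Site 2 := (u + triDir (a + 5), u + triDir a)

/-- The boundary dart after the block: from the first inside neighbour back to the last outside one. [folklore] -/
def dPlus (u : LatticeModels.Site 2) (a m : Fin 6) : LatticeModels.Site 2 × LatticeModels.Site 2 :=
  (u + triDir (a + m), u + triDir (a + (m - 1)))

section NoHyp

variable {u : LatticeModels.Site 2} {a m : Fin 6}

/-- `5 + 1 = 0` in `Fin 6`. [folklore] -/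
theorem fin6_five_add_one : (5 : Fin 6) + 1 = 0 := by decide

/-- Every direction is `a + t` for a unique offset `t`. [folklore] -/
theorem exists_offset (a j : Fin 6) : ∃ t : Fin 6, j = a + t := ⟨j - a, by abel⟩

/-- `m ≤ 5` (at least one neighbour inside), for free from `m : Fin 6`. [folklore] -/
theorem le_five {G : Finset (LatticeModels.Site 2)} (_h : RemovableAt G u a m) : m.val ≤ 5 :=
  Nat.lt_succ_iff.1 m.isLt

/-- The value of `t + 1` below the top. [folklore] -/
theorem val_add_one_of_lt {t : Fin 6} (ht : t.val < 5) : (t + 1).val = t.val + 1 := by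
  rw [Fin.val_add_one]
  split_ifs with h5
  · simp [h5] at ht
  · rfl

/-- `dMinus` as a dart between consecutive neighbours. [folklore] -/
theorem dMinus_eq : dMinus u a = (u + triDir (a + 5), u + triDir (a + 5 + 1)) := by
  rw [dMinus, add_assoc a, fin6_five_add_one, add_zero]

/-- `dPlus` as a dart between consecutive neighbours. [folklore] -/
theorem dPlus_eq : dPlus u a m = (u + triDir (a + (m - 1) + 1), u + triDir (a + (m - 1))) := by
  rw [dPlus, add_assoc a, sub_add_cancel]

/-- The apex of the left face of `dMinus` is `u`. [folklore] -/
theorem triLeftApex_dMinus : triLeftApex (dMinus u a).1 (dMinus u a).2 = u := by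
  rw [dMinus_eq]; exact triLeftApex_consec u _

/-- `dMinus ≠ dPlus`. [folklore] -/
theorem dMinus_ne_dPlus : dMinus u a ≠ dPlus u a m := by
  intro e
  have h1 : u + triDir (a + 5) = u + triDir (a + m) := congrArg Prod.fst e
  have h3 : (5 : Fin 6) = m := add_left_cancel (triDir_injective (add_left_cancel h1))
  have h4 : u + triDir a = u + triDir (a + (m - 1)) := congrArg Prod.snd e
  have h5 : a + 0 = a + (m - 1) := by rw [add_zero]; exact triDir_injective (add_left_cancel h4)
  have h6 : (0 : Fin 6) = m - 1 := add_left_cancel h5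
  rw [← h3] at h6
  exact absurd h6 (by decide)

end NoHyp

variable {G : Finset (LatticeModels.Site 2)} {u : LatticeModels.Site 2} {a m : Fin 6} (h : RemovableAt G u a m)
include h

/-- Outside directions. [folklore] -/
theorem out {t : Fin 6} (ht : t.val < m.val) : u + triDir (a + t) ∉ G := (h.out_iff t).2 ht

/-- Inside directions. [folklore] -/
theorem inside {t : Fin 6} (ht : m.val ≤ t.val) : u + triDir (a + t) ∈ G := by
  by_contra hn
  have := (h.out_iff t).1 hn
  omega

/-- The value of `m - 1`. [folklore] -/
theorem val_sub_one : (m - 1).val = m.val - 1 := by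
  rw [Fin.coe_sub_one]
  have := h.one_le
  split_ifs with h0
  · simp [h0] at this
  · rfl

/-- The block darts are boundary darts of `G`. [folklore] -/
theorem blk_mem {t : Fin 6} (ht : t.val < m.val) : blk u a t ∈ triBdryDarts G :=
  mem_triBdryDarts.2 ⟨h.mem, h.out ht, triGraph_adj_add_triDir _ _⟩

/-- `dMinus` is a boundary dart of `G`. [folklore] -/
theorem dMinus_mem : dMinus u a ∈ triBdryDarts G := by
  rw [dMinus_eq, mem_triBdryDarts]
  refine ⟨h.inside (t := 5) (by have := h.le_five; simp; omega), ?_, triGraph_adj_consec u _⟩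
  rw [add_assoc, fin6_five_add_one]
  exact h.out (t := 0) (by simp; exact h.one_le)

/-- `dPlus` is a boundary dart of `G`. [folklore] -/
theorem dPlus_mem : dPlus u a m ∈ triBdryDarts G := by
  rw [dPlus_eq, mem_triBdryDarts]
  refine ⟨?_, h.out (t := m - 1) ?_, (triGraph_adj_consec u _).symm⟩
  · rw [add_assoc, sub_add_cancel]; exact h.inside (t := m) le_rfl
  · rw [h.val_sub_one]; have := h.one_le; omega

/-- **Successor inside the block**: the boundary turns left around `H_u`. [folklore] -/
theorem succ_blk {t : Fin 6} (ht : t.val + 1 < m.val) :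
    triBdrySucc G (blk u a t) = blk u a (t + 1) := by
  have ht' : (t + 1).val = t.val + 1 := val_add_one_of_lt (t := t) (by have := h.le_five; omega)
  simp only [blk, triBdrySucc, triLeftApex_add_triDir, add_assoc a t 1]
  rw [if_neg (h.out (by rw [ht']; exact ht))]

/-- **Successor of the last block dart** is `dPlus` (a right turn, the apex being inside). [folklore] -/
theorem succ_blk_last : triBdrySucc G (blk u a (m - 1)) = dPlus u a m := by
  simp only [blk, triBdrySucc, triLeftApex_add_triDir, add_assoc a (m - 1) 1, sub_add_cancel]
  rw [if_pos (h.inside le_rfl), dPlus]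

/-- **Successor of `dMinus` in `G`** is the first block dart. [folklore] -/
theorem succ_dMinus : triBdrySucc G (dMinus u a) = blk u a 0 := by
  rw [triBdrySucc, triLeftApex_dMinus, if_pos h.mem, blk, dMinus, add_zero]

/-- **A boundary dart of `G` whose left apex is `u` is `dMinus`.** [folklore] -/
theorem eq_dMinus_of_triLeftApex_eq {d : LatticeModels.Site 2 × LatticeModels.Site 2} (hd : d ∈ triBdryDarts G)
    (hap : triLeftApex d.1 d.2 = u) : d = dMinus u a := by
  obtain ⟨hx, hy, hadj⟩ := mem_triBdryDarts.1 hd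
  obtain ⟨k, hk⟩ := (triGraph_adj_iff_triDir d.1 d.2).1 hadj
  rw [hk, triLeftApex_add_triDir] at hap
  -- `d.1 = u + triDir (k + 4)`, `d.2 = u + triDir (k + 4 + 1)`
  have hx' : d.1 = u + triDir (k + 1 + 3) := by
    rw [triDir_add_three, ← hap, add_neg_cancel_right]
  have hy' : d.2 = u + triDir (k + 1 + 3 + 1) := by
    rw [hk, hx', add_assoc u, ← triDir_add_triDir_add_two (k + 1 + 3)]
    congr 2
    rw [add_assoc, add_assoc, show (1 : Fin 6) + (3 + 2) = 0 by decide, add_zero]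
  obtain ⟨t, ht⟩ := exists_offset a (k + 1 + 3)
  rw [ht] at hx' hy'
  rw [add_assoc] at hy'
  have hin : ¬ t.val < m.val := fun hlt => h.out hlt (hx' ▸ hx)
  have hout : (t + 1).val < m.val := (h.out_iff (t + 1)).1 (hy' ▸ hy)
  have ht5 : t = 5 := by
    rw [Fin.val_add_one] at hout
    split_ifs at hout with h5
    · exact h5
    · omega
  subst ht5
  rw [dMinus_eq]
  exact Prod.ext hx' (by rw [hy', add_assoc])

/-! ### Positions of the block in the boundary cycle -/

omit h in
/-- **Predecessor position**: if the successor of the boundary dart `d` sits at position `n`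
(`1 ≤ n ≤ #∂G`) of a disc traversal, then `d` sits at position `n - 1`. [folklore] -/
theorem _root_.Literature.Probability.Percolation.IsTriDisc.eq_iter_pred {G : Finset (LatticeModels.Site 2)} {b : LatticeModels.Site 2 × LatticeModels.Site 2}
    (hD : IsTriDisc G b) {d : LatticeModels.Site 2 × LatticeModels.Site 2} (hd : d ∈ triBdryDarts G) {n : ℕ} (hn1 : 1 ≤ n)
    (hnL : n ≤ #(triBdryDarts G)) (hs : triBdrySucc G d = triBdryIter G b n) :
    d = triBdryIter G b (n - 1) := by
  obtain ⟨n', hn', rfl⟩ := hD.cycle d hd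
  rw [← triBdryIter_succ, hD.iter_eq_iter_iff] at hs
  congr 1
  rcases hnL.lt_or_eq with hlt | rfl
  · rw [Nat.mod_eq_of_lt hlt] at hs
    rcases (Nat.succ_le_of_lt hn').lt_or_eq with hlt' | heq
    · rw [Nat.mod_eq_of_lt hlt'] at hs; omega
    · rw [show n' + 1 = #(triBdryDarts G) from heq, Nat.mod_self] at hs; omega
  · rw [Nat.mod_self] at hs
    rcases (Nat.succ_le_of_lt hn').lt_or_eq with hlt' | heq
    · rw [Nat.mod_eq_of_lt hlt'] at hs; omega
    · have : n' + 1 = #(triBdryDarts G) := heq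
      omega

/-- The disc traversed from `dPlus`. [folklore] -/
theorem isTriDisc_dPlus {b : LatticeModels.Site 2 × LatticeModels.Site 2} (hD : IsTriDisc G b) : IsTriDisc G (dPlus u a m) :=
  hD.rebase h.dPlus_mem

omit h in
/-- The tail of a block dart is `u`; of `dPlus` it is not. [folklore] -/
theorem blk_ne_dPlus (t : Fin 6) : blk u a t ≠ dPlus u a m := fun e =>
  add_triDir_ne u (a + m) (congrArg Prod.fst e).symm

/-- **The block occupies the last `m` positions** of the traversal from `dPlus`: position
`#∂G - 1 - s` carries the block dart of offset `m - 1 - s` (`s < m`). [folklore] -/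
theorem iter_block {b : LatticeModels.Site 2 × LatticeModels.Site 2} (hD : IsTriDisc G b) :
    ∀ s : ℕ, ∀ hs : s < m.val, s + 1 ≤ #(triBdryDarts G) ∧
      triBdryIter G (dPlus u a m) (#(triBdryDarts G) - 1 - s) =
        blk u a ⟨m.val - 1 - s, by omega⟩ := by
  have hP := h.isTriDisc_dPlus hD
  intro s
  induction s with
  | zero =>
    intro hs
    have e : (⟨m.val - 1 - 0, by omega⟩ : Fin 6) = m - 1 := Fin.ext (by rw [h.val_sub_one]; rfl)
    refine ⟨hP.card_pos, ?_⟩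
    rw [e, Nat.sub_zero]
    exact (hP.eq_iter_pred (h.blk_mem (by rw [h.val_sub_one]; omega)) hP.card_pos le_rfl
      (by rw [h.succ_blk_last, hP.cycle_len])).symm
  | succ s ih =>
    intro hs
    obtain ⟨hsL, hit⟩ := ih (by omega)
    set t' : Fin 6 := ⟨m.val - 1 - (s + 1), by omega⟩ with ht'
    have ht'1 : t' + 1 = ⟨m.val - 1 - s, by omega⟩ := by
      apply Fin.ext
      rw [val_add_one_of_lt (t := t') (by simp [ht']; omega)]
      simp [ht']; omega
    have hsucc : triBdrySucc G (blk u a t') = triBdryIter G (dPlus u a m)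
        (#(triBdryDarts G) - 1 - s) := by
      rw [h.succ_blk (by simp [ht']; omega), ht'1, hit]
    -- the position `#∂G - 1 - s` is not `0`
    have hpos : 1 ≤ #(triBdryDarts G) - 1 - s := by
      by_contra h0
      push Not at h0
      have h00 : #(triBdryDarts G) - 1 - s = 0 := by omega
      rw [h00] at hit
      exact blk_ne_dPlus _ hit.symm
    refine ⟨by omega, ?_⟩
    have := hP.eq_iter_pred (h.blk_mem (by simp [ht']; omega)) hpos (by omega) hsucc
    rw [this]
    congr 1

/-- **`dMinus` sits just before the block**, at position `#∂G - m - 1`, and `#∂G ≥ m + 2`. [folklore] -/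
theorem iter_dMinus {b : LatticeModels.Site 2 × LatticeModels.Site 2} (hD : IsTriDisc G b) :
    m.val + 2 ≤ #(triBdryDarts G) ∧
      triBdryIter G (dPlus u a m) (#(triBdryDarts G) - m.val - 1) = dMinus u a := by
  have hP := h.isTriDisc_dPlus hD
  obtain ⟨hmL, hit⟩ := h.iter_block hD (m.val - 1) (by have := h.one_le; omega)
  have e0 : (⟨m.val - 1 - (m.val - 1), by omega⟩ : Fin 6) = 0 := Fin.ext (by simp)
  rw [e0] at hit
  have hLm : #(triBdryDarts G) - 1 - (m.val - 1) = #(triBdryDarts G) - m.val := by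
    have := h.one_le; omega
  rw [hLm] at hit
  have hsucc : triBdrySucc G (dMinus u a) = triBdryIter G (dPlus u a m)
      (#(triBdryDarts G) - m.val) := by rw [h.succ_dMinus, hit]
  have hpos : 1 ≤ #(triBdryDarts G) - m.val := by
    by_contra h0
    push Not at h0
    have h00 : #(triBdryDarts G) - m.val = 0 := by omega
    rw [h00] at hit
    exact blk_ne_dPlus _ hit.symm
  have hdm := hP.eq_iter_pred h.dMinus_mem hpos (Nat.sub_le _ _) hsucc
  have e1 : #(triBdryDarts G) - m.val - 1 = #(triBdryDarts G) - ↑m - 1 := rfl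
  refine ⟨?_, by rw [hdm]⟩
  by_contra hlt
  push Not at hlt
  have h00 : #(triBdryDarts G) - m.val - 1 = 0 := by omega
  rw [h00] at hdm
  exact dMinus_ne_dPlus hdm

/-- **Off the block the tails are not `u`**: positions `< #∂G - m`. [folklore] -/
theorem iter_fst_ne {b : LatticeModels.Site 2 × LatticeModels.Site 2} (hD : IsTriDisc G b) {n : ℕ}
    (hn : n < #(triBdryDarts G) - m.val) : (triBdryIter G (dPlus u a m) n).1 ≠ u := by
  have hP := h.isTriDisc_dPlus hD
  intro hu
  set d := triBdryIter G (dPlus u a m) n with hd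
  have hdm : d ∈ triBdryDarts G := triBdryIter_mem h.dPlus_mem n
  obtain ⟨-, hy, hadj⟩ := mem_triBdryDarts.1 hdm
  obtain ⟨j, hj⟩ := (triGraph_adj_iff_triDir d.1 d.2).1 hadj
  obtain ⟨t, rfl⟩ := exists_offset a j
  rw [hu] at hj
  have ht : t.val < m.val := (h.out_iff t).1 (hj ▸ hy)
  -- `d = blk u a t`, which sits at position `#∂G - 1 - s`, `s = m - 1 - t`
  obtain ⟨-, hit⟩ := h.iter_block hD (m.val - 1 - t.val) (by omega)
  have e : (⟨m.val - 1 - (m.val - 1 - t.val), by omega⟩ : Fin 6) = t := Fin.ext (by simp; omega)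
  rw [e] at hit
  have hdeq : d = blk u a t := Prod.ext hu hj
  rw [hd, ← hit, hP.iter_eq_iter_iff, Nat.mod_eq_of_lt (by omega),
    Nat.mod_eq_of_lt (by omega)] at hdeq
  omega

/-! ### The boundary of `G ∖ {u}` -/

omit h in
/-- Boundary darts after removing `u`. [folklore] -/
theorem mem_triBdryDarts_erase {G : Finset (LatticeModels.Site 2)} {u : LatticeModels.Site 2} {d : LatticeModels.Site 2 × LatticeModels.Site 2} :
    d ∈ triBdryDarts (G.erase u) ↔
      (d.1 ≠ u ∧ d.1 ∈ G) ∧ (d.2 ∉ G ∨ d.2 = u) ∧ LatticeModels.triGraph.Adj d.1 d.2 := by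
  rw [mem_triBdryDarts, mem_erase, mem_erase]
  constructor
  · rintro ⟨h1, h2, h3⟩
    refine ⟨h1, ?_, h3⟩
    by_cases h : d.2 = u
    · exact Or.inr h
    · exact Or.inl fun h' => h2 ⟨h, h'⟩
  · rintro ⟨h1, h2, h3⟩
    refine ⟨h1, ?_, h3⟩
    rintro ⟨hne, hin⟩
    rcases h2 with h2 | h2
    · exact h2 hin
    · exact hne h2

omit h in
/-- Old boundary darts not out of `u` remain boundary darts. [folklore] -/
theorem mem_erase_of_mem {G : Finset (LatticeModels.Site 2)} {u : LatticeModels.Site 2} {d : LatticeModels.Site 2 × LatticeModels.Site 2}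
    (hd : d ∈ triBdryDarts G) (hne : d.1 ≠ u) : d ∈ triBdryDarts (G.erase u) := by
  obtain ⟨h1, h2, h3⟩ := mem_triBdryDarts.1 hd
  exact mem_triBdryDarts_erase.2 ⟨⟨hne, h1⟩, Or.inl h2, h3⟩

/-- The new darts into `u` from its inside neighbours are boundary darts of `G ∖ {u}`. [folklore] -/
theorem nw_mem {t : Fin 6} (ht : m.val ≤ t.val) : nw u a t ∈ triBdryDarts (G.erase u) :=
  mem_triBdryDarts_erase.2 ⟨⟨add_triDir_ne _ _, h.inside ht⟩, Or.inr rfl,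
    (triGraph_adj_add_triDir _ _).symm⟩

/-- `dPlus` is a boundary dart of `G ∖ {u}`. [folklore] -/
theorem dPlus_mem_erase : dPlus u a m ∈ triBdryDarts (G.erase u) :=
  mem_erase_of_mem h.dPlus_mem (add_triDir_ne _ _)

/-- **The successor is unchanged at old darts other than `dMinus`.** [folklore] -/
theorem succ_erase_eq {d : LatticeModels.Site 2 × LatticeModels.Site 2} (hd : d ∈ triBdryDarts G)
    (hdm : d ≠ dMinus u a) : triBdrySucc (G.erase u) d = triBdrySucc G d := by
  have hap : triLeftApex d.1 d.2 ≠ u := fun e => hdm (h.eq_dMinus_of_triLeftApex_eq hd e)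
  simp only [triBdrySucc, mem_erase, ne_eq, hap, not_false_eq_true, true_and]

omit h in
/-- **The successor of `dMinus` in `G ∖ {u}`** is the first new dart. [folklore] -/
theorem succ_erase_dMinus : triBdrySucc (G.erase u) (dMinus u a) = nw u a 5 := by
  rw [triBdrySucc, triLeftApex_dMinus, if_neg (fun h' => (mem_erase.1 h').1 rfl), nw, dMinus]

/-- **The successor of a new dart** turns around `H_u` from outside: clockwise in the offsets. [folklore] -/
theorem succ_erase_nw {t : Fin 6} (ht : m.val < t.val) :
    triBdrySucc (G.erase u) (nw u a t) = nw u a (t + 5) := by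
  have ht5 : (t + 5).val = t.val - 1 := by
    rw [Fin.val_add]; simp; omega
  simp only [nw, triBdrySucc, triLeftApex_add_triDir_left, add_assoc a t 5]
  rw [if_pos (mem_erase.2 ⟨add_triDir_ne _ _, h.inside (by rw [ht5]; omega)⟩)]

/-- **The successor of the last new dart is `dPlus`.** [folklore] -/
theorem succ_erase_nw_last : triBdrySucc (G.erase u) (nw u a m) = dPlus u a m := by
  have e : m + 5 = m - 1 := by rw [sub_eq_add_neg]; congr 1
  simp only [nw, triBdrySucc, triLeftApex_add_triDir_left, add_assoc a m 5, e]
  rw [if_neg (fun h' => h.out (t := m - 1) (by rw [h.val_sub_one]; have := h.one_le; omega)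
    (mem_erase.1 h').2), dPlus]

/-! ### The boundary cycle of `G ∖ {u}` -/

omit h in
/-- A natural number `≤ 5` as an element of `Fin 6` (`Fin.ofNat`). [folklore] -/
theorem val_ofNat_of_le {k : ℕ} (hk : k ≤ 5) : (Fin.ofNat 6 k).val = k := by
  rw [Fin.val_ofNat]; omega

/-- **The boundary traversal of `G ∖ {u}` from `dPlus`**: the old traversal up to `dMinus`
(positions `≤ #∂G - m - 1`), then the new darts `nw 5, nw 4, …, nw m`. [folklore] -/
def newIter (G : Finset (LatticeModels.Site 2)) (u : LatticeModels.Site 2) (a m : Fin 6) (n : ℕ) : LatticeModels.Site 2 × LatticeModels.Site 2 :=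
  if n ≤ #(triBdryDarts G) - m.val - 1 then triBdryIter G (dPlus u a m) n
  else nw u a (Fin.ofNat 6 (#(triBdryDarts G) + 5 - m.val - n))

/-- **The traversal of `∂(G ∖ {u})` from `dPlus` follows `newIter`** for `#∂G + 5 - 2m` steps,
and closes up at the next. [folklore] -/
theorem iter_erase_eq {b : LatticeModels.Site 2 × LatticeModels.Site 2} (hD : IsTriDisc G b) :
    (∀ n, n ≤ #(triBdryDarts G) + 5 - 2 * m.val →
      triBdryIter (G.erase u) (dPlus u a m) n = newIter G u a m n) ∧
    triBdryIter (G.erase u) (dPlus u a m) (#(triBdryDarts G) + 6 - 2 * m.val) = dPlus u a m := by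
  have hP := h.isTriDisc_dPlus hD
  obtain ⟨hL2, hdm⟩ := h.iter_dMinus hD
  have h5 := h.le_five
  have h1 := h.one_le
  set L := #(triBdryDarts G) with hL
  -- one step of the new traversal
  have step : ∀ n, n < L + 5 - 2 * m.val →
      triBdrySucc (G.erase u) (newIter G u a m n) = newIter G u a m (n + 1) := by
    intro n hn
    by_cases hn1 : n < L - m.val - 1
    · -- an old dart other than `dMinus`
      have e1 : newIter G u a m n = triBdryIter G (dPlus u a m) n := if_pos hn1.le
      have e2 : newIter G u a m (n + 1) = triBdryIter G (dPlus u a m) (n + 1) := if_pos (by omega)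
      rw [e1, e2, triBdryIter_succ]
      refine h.succ_erase_eq (triBdryIter_mem h.dPlus_mem n) fun e => ?_
      rw [← hdm, hP.iter_eq_iter_iff, Nat.mod_eq_of_lt (by omega), Nat.mod_eq_of_lt (by omega)] at e
      omega
    by_cases hn2 : n = L - m.val - 1
    · -- `dMinus`
      have e1 : newIter G u a m n = dMinus u a := by rw [newIter, if_pos hn2.le, hn2, hdm]
      have e2 : newIter G u a m (n + 1) = nw u a 5 := by
        rw [newIter, if_neg (by omega)]
        congr 1
        apply Fin.ext
        rw [val_ofNat_of_le (by omega)]; simp; omega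
      rw [e1, e2, succ_erase_dMinus]
    · -- a new dart other than the last
      have hk5 : L + 5 - m.val - n ≤ 5 := by omega
      have hkm : m.val < L + 5 - m.val - n := by omega
      have e1 : newIter G u a m n = nw u a (Fin.ofNat 6 (L + 5 - m.val - n)) := if_neg (by omega)
      have e2 : newIter G u a m (n + 1) = nw u a (Fin.ofNat 6 (L + 5 - m.val - (n + 1))) :=
        if_neg (by omega)
      rw [e1, e2, h.succ_erase_nw (by rw [val_ofNat_of_le hk5]; exact hkm)]
      congr 1
      apply Fin.ext
      rw [Fin.val_add, val_ofNat_of_le hk5, val_ofNat_of_le (by omega)]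
      simp; omega
  have main : ∀ n, n ≤ L + 5 - 2 * m.val →
      triBdryIter (G.erase u) (dPlus u a m) n = newIter G u a m n := by
    intro n
    induction n with
    | zero => intro; rw [triBdryIter_zero, newIter, if_pos (Nat.zero_le _), triBdryIter_zero]
    | succ n ih =>
      intro hn
      rw [triBdryIter_succ, ih (by omega), step n (by omega)]
  refine ⟨main, ?_⟩
  have e : L + 6 - 2 * m.val = (L + 5 - 2 * m.val) + 1 := by omega
  rw [e, triBdryIter_succ, main _ le_rfl, newIter, if_neg (by omega)]
  have ek : Fin.ofNat 6 (L + 5 - m.val - (L + 5 - 2 * m.val)) = m := by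
    apply Fin.ext; rw [val_ofNat_of_le (by omega)]; omega
  rw [ek, h.succ_erase_nw_last]

/-- The number of outside directions is `m`. [folklore] -/
theorem card_filter_out : #(univ.filter fun j : Fin 6 => u + triDir j ∉ G) = m.val := by
  have e : (univ.filter fun j : Fin 6 => u + triDir j ∉ G) =
      (univ.filter fun t : Fin 6 => t.val < m.val).image fun t => a + t := by
    ext j
    simp only [mem_filter, mem_univ, true_and, mem_image]
    constructor
    · intro hj
      obtain ⟨t, rfl⟩ := exists_offset a j
      exact ⟨t, (h.out_iff t).1 hj, rfl⟩
    · rintro ⟨t, ht, rfl⟩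
      exact h.out ht
  rw [e, card_image_of_injective _ (add_right_injective a)]
  have h5 := h.le_five
  rcases m with ⟨m, hm⟩
  simp only at h5 ⊢
  interval_cases m <;> decide

/-- The number of inside directions is `6 - m`. [folklore] -/
theorem card_filter_in : #(univ.filter fun j : Fin 6 => u + triDir j ∈ G) = 6 - m.val := by
  have := card_filter_add_card_filter_not (s := (univ : Finset (Fin 6)))
    (fun j : Fin 6 => u + triDir j ∈ G)
  simp only [card_univ, Fintype.card_fin] at this
  have h2 : #(univ.filter fun j : Fin 6 => ¬ u + triDir j ∈ G) = m.val := h.card_filter_out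
  omega

omit h in
/-- **The boundary of `G ∖ {u}`**: the old darts not out of `u` and the new darts into `u`. [folklore] -/
theorem triBdryDarts_erase_eq :
    triBdryDarts (G.erase u) = (triBdryDarts G).filter (fun d => d.1 ≠ u) ∪
      (univ.filter fun j : Fin 6 => u + triDir j ∈ G).image fun j => (u + triDir j, u) := by
  ext d
  rw [mem_union, mem_filter, mem_triBdryDarts_erase, mem_triBdryDarts, mem_image]
  simp only [mem_filter, mem_univ, true_and]
  constructor
  · rintro ⟨⟨hne, h1⟩, h2 | h2, hadj⟩
    · exact Or.inl ⟨⟨h1, h2, hadj⟩, hne⟩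
    · right
      obtain ⟨j, hj⟩ := (triGraph_adj_iff_triDir d.2 d.1).1 hadj.symm
      rw [h2] at hj
      refine ⟨j, hj ▸ h1, Prod.ext hj.symm h2.symm⟩
  · rintro (⟨⟨h1, h2, hadj⟩, hne⟩ | ⟨j, hj, rfl⟩)
    · exact ⟨⟨hne, h1⟩, Or.inl h2, hadj⟩
    · exact ⟨⟨add_triDir_ne _ _, hj⟩, Or.inr rfl, (triGraph_adj_add_triDir _ _).symm⟩

/-- **The length of the new boundary**: `#∂(G ∖ {u}) = #∂G + 6 - 2m`. [folklore] -/
theorem card_triBdryDarts_erase : #(triBdryDarts (G.erase u)) = #(triBdryDarts G) + 6 - 2 * m.val := by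
  have hinj : Function.Injective fun j : Fin 6 => (u + triDir j, u) := fun i j hij =>
    triDir_injective (by simpa using hij)
  rw [triBdryDarts_erase_eq, card_union_of_disjoint, card_image_of_injective _ hinj,
    h.card_filter_in]
  · have hneg : #((triBdryDarts G).filter fun d => ¬ d.1 ≠ u) = m.val := by
      have e : ((triBdryDarts G).filter fun d => ¬ d.1 ≠ u) =
          (triBdryDarts G).filter fun d => d.1 = u := filter_congr fun d _ => by simp
      rw [e, filter_fst_eq G h.mem, card_image_of_injective, h.card_filter_out]
      exact fun i j hij => triDir_injective (by simpa using hij)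
    have := card_filter_add_card_filter_not (s := triBdryDarts G) (fun d => d.1 ≠ u)
    have h5 := h.le_five
    omega
  · rw [disjoint_left]
    rintro d hd hd'
    obtain ⟨j, -, rfl⟩ := mem_image.1 hd'
    obtain ⟨hd, -⟩ := mem_filter.1 hd
    exact (mem_triBdryDarts.1 hd).2.1 h.mem

/-- **The new traversal is injective on a period.** [folklore] -/
theorem newIter_injOn {b : LatticeModels.Site 2 × LatticeModels.Site 2} (hD : IsTriDisc G b) {i j : ℕ}
    (hi : i < #(triBdryDarts G) + 6 - 2 * m.val) (hj : j < #(triBdryDarts G) + 6 - 2 * m.val)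
    (he : newIter G u a m i = newIter G u a m j) : i = j := by
  have hP := h.isTriDisc_dPlus hD
  obtain ⟨hL2, -⟩ := h.iter_dMinus hD
  have h5 := h.le_five
  set L := #(triBdryDarts G) with hL
  -- heads of old darts are outside `G`, heads of new darts are `u ∈ G`
  have hold : ∀ n, n ≤ L - m.val - 1 → (newIter G u a m n).2 ∉ G := by
    intro n hn
    rw [newIter, if_pos hn]
    exact (mem_triBdryDarts.1 (triBdryIter_mem h.dPlus_mem n)).2.1
  have hnew : ∀ n, ¬ n ≤ L - m.val - 1 → (newIter G u a m n).2 = u := by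
    intro n hn; rw [newIter, if_neg hn]; rfl
  by_cases hi1 : i ≤ L - m.val - 1 <;> by_cases hj1 : j ≤ L - m.val - 1
  · rw [newIter, if_pos hi1, newIter, if_pos hj1, hP.iter_eq_iter_iff, Nat.mod_eq_of_lt (by omega),
      Nat.mod_eq_of_lt (by omega)] at he
    exact he
  · exact absurd (hnew j hj1 ▸ h.mem) (he ▸ hold i hi1)
  · exact absurd (hnew i hi1 ▸ h.mem) (he.symm ▸ hold j hj1)
  · rw [newIter, if_neg hi1, newIter, if_neg hj1, nw, nw, Prod.mk.injEq] at he
    have := triDir_injective (add_left_cancel he.1)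
    have := congrArg Fin.val (add_left_cancel this)
    rw [val_ofNat_of_le (by omega), val_ofNat_of_le (by omega)] at this
    omega

/-! ### The Euler characteristic is unchanged -/

omit h in
/-- The adjacent pairs avoiding `u`. [folklore] -/
theorem triAdjPairs_erase (G : Finset (LatticeModels.Site 2)) (u : LatticeModels.Site 2) :
    triAdjPairs (G.erase u) = (triAdjPairs G).filter fun p => p.1 ≠ u ∧ p.2 ≠ u := by
  ext p
  simp only [mem_triAdjPairs, mem_erase, mem_filter]
  tauto

/-- **The adjacent pairs through `u`**: `2 (6 - m)` of them. [folklore] -/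
theorem card_triAdjPairs_filter :
    #((triAdjPairs G).filter fun p => ¬ (p.1 ≠ u ∧ p.2 ≠ u)) = 2 * (6 - m.val) := by
  have e : ((triAdjPairs G).filter fun p => ¬ (p.1 ≠ u ∧ p.2 ≠ u)) =
      (univ.filter fun j : Fin 6 => u + triDir j ∈ G).image (fun j => (u, u + triDir j)) ∪
        (univ.filter fun j : Fin 6 => u + triDir j ∈ G).image fun j => (u + triDir j, u) := by
    ext ⟨x, y⟩
    simp only [mem_filter, mem_triAdjPairs, mem_union, mem_image, mem_univ, true_and,
      Prod.mk.injEq, not_and_or, not_not]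
    constructor
    · rintro ⟨⟨hx, hy, hadj⟩, rfl | rfl⟩
      · obtain ⟨j, rfl⟩ := (triGraph_adj_iff_triDir x y).1 hadj
        exact Or.inl ⟨j, hy, rfl, rfl⟩
      · obtain ⟨j, rfl⟩ := (triGraph_adj_iff_triDir y x).1 hadj.symm
        exact Or.inr ⟨j, hx, rfl, rfl⟩
    · rintro (⟨j, hj, rfl, rfl⟩ | ⟨j, hj, rfl, rfl⟩)
      · exact ⟨⟨h.mem, hj, triGraph_adj_add_triDir _ _⟩, Or.inl rfl⟩
      · exact ⟨⟨hj, h.mem, (triGraph_adj_add_triDir _ _).symm⟩, Or.inr rfl⟩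
  rw [e, card_union_of_disjoint, card_image_of_injective, card_image_of_injective,
    h.card_filter_in]
  · ring
  · exact fun i j hij => triDir_injective (by simpa using hij)
  · exact fun i j hij => triDir_injective (by simpa using hij)
  · rw [disjoint_left]
    rintro p hp hp'
    obtain ⟨j, -, rfl⟩ := mem_image.1 hp
    obtain ⟨j', -, hj'⟩ := mem_image.1 hp'
    exact add_triDir_ne u j' (congrArg Prod.fst hj')

omit h in
/-- The faces inside `G ∖ {u}` are the faces inside `G` avoiding `u`. [folklore] -/
theorem triFacesIn_erase (G : Finset (LatticeModels.Site 2)) (u : LatticeModels.Site 2) :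
    triFacesIn (G.erase u) = (triFacesIn G).filter fun w => u ∉ LatticeModels.hexFaceVertices w := by
  ext w
  simp only [mem_triFacesIn, mem_filter, subset_erase]

omit h in
/-- The vertices of the face left of `u → u + triDir j`. [folklore] -/
theorem hexFaceVertices_leftFaceDir (u : LatticeModels.Site 2) (j : Fin 6) :
    LatticeModels.hexFaceVertices (leftFaceDir u j) = {u, u + triDir j, u + triDir (j + 1)} := by
  have := hexFaceVertices_leftFace (triGraph_adj_add_triDir u j)
  rwa [leftFace, dirOf_add_triDir, triLeftApex_add_triDir] at this

omit h in
/-- `leftFaceDir u` is injective. [folklore] -/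
theorem leftFaceDir_injective (u : LatticeModels.Site 2) : Function.Injective (leftFaceDir u) := by
  have := card_image_iff.1 (show #(univ.image (leftFaceDir u)) = #(univ : Finset (Fin 6)) by
    rw [← facesAt_eq_image_leftFaceDir, card_facesAt, card_univ, Fintype.card_fin])
  intro i j hij
  exact this (mem_coe.2 (mem_univ i)) (mem_coe.2 (mem_univ j)) hij

/-- **The faces inside `G` at `u`**: `5 - m` of them (consecutive inside neighbours). [folklore] -/
theorem card_triFacesIn_filter :
    #((triFacesIn G).filter fun w => ¬ u ∉ LatticeModels.hexFaceVertices w) = 5 - m.val := by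
  have e : ((triFacesIn G).filter fun w => ¬ u ∉ LatticeModels.hexFaceVertices w) =
      (univ.filter fun t : Fin 6 => m.val ≤ t.val ∧ t.val ≤ 4).image
        fun t => leftFaceDir u (a + t) := by
    ext w
    simp only [mem_filter, mem_triFacesIn, not_not, mem_image, mem_univ, true_and]
    constructor
    · rintro ⟨hsub, huw⟩
      obtain ⟨j, rfl⟩ : ∃ j, w = leftFaceDir u j := by
        have := mem_facesAt.2 huw
        rw [facesAt_eq_image_leftFaceDir] at this
        obtain ⟨j, -, rfl⟩ := mem_image.1 this
        exact ⟨j, rfl⟩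
      obtain ⟨t, rfl⟩ := exists_offset a j
      rw [hexFaceVertices_leftFaceDir] at hsub
      have h1 : u + triDir (a + t) ∈ G := hsub (by simp)
      have h2 : u + triDir (a + t + 1) ∈ G := hsub (by simp)
      have ht : ¬ t.val < m.val := fun hlt => h.out hlt h1
      have ht1 : ¬ (t + 1).val < m.val := fun hlt => h.out hlt (by rwa [add_assoc] at h2)
      refine ⟨t, ⟨by omega, ?_⟩, rfl⟩
      by_contra h4
      have ht5 : t = 5 := Fin.ext (by simp; omega)
      rw [ht5, fin6_five_add_one] at ht1
      exact ht1 (by simp; exact h.one_le)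
    · rintro ⟨t, ⟨hmt, ht4⟩, rfl⟩
      rw [hexFaceVertices_leftFaceDir]
      refine ⟨?_, by simp⟩
      intro z hz
      simp only [mem_insert, mem_singleton] at hz
      rcases hz with rfl | rfl | rfl
      · exact h.mem
      · exact h.inside hmt
      · rw [add_assoc]; exact h.inside (by rw [val_add_one_of_lt (by omega)]; omega)
  rw [e, card_image_of_injective]
  · have h5 := h.le_five
    rcases m with ⟨m, hm⟩
    simp only at h5 ⊢
    interval_cases m <;> decide
  · intro i j hij
    exact add_right_injective a (leftFaceDir_injective u hij)

/-- **Removing a removable hexagon preserves the Euler characteristic.** [folklore] -/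
theorem triEulerTwice_erase : triEulerTwice (G.erase u) = triEulerTwice G := by
  unfold triEulerTwice
  have hV : #(G.erase u) + 1 = #G := card_erase_add_one h.mem
  have hP : #(triAdjPairs (G.erase u)) + 2 * (6 - m.val) = #(triAdjPairs G) := by
    rw [triAdjPairs_erase, ← h.card_triAdjPairs_filter, card_filter_add_card_filter_not]
  have hF : #(triFacesIn (G.erase u)) + (5 - m.val) = #(triFacesIn G) := by
    rw [triFacesIn_erase, ← h.card_triFacesIn_filter, card_filter_add_card_filter_not]
  have h5 := h.le_five
  omega

/-- **Shelling step: removing a removable boundary hexagon from a disc leaves a disc**, based at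
`dPlus`. [folklore] -/
theorem isTriDisc_erase {b : LatticeModels.Site 2 × LatticeModels.Site 2} (hD : IsTriDisc G b) :
    IsTriDisc (G.erase u) (dPlus u a m) := by
  obtain ⟨hmain, hclose⟩ := h.iter_erase_eq hD
  have hcard := h.card_triBdryDarts_erase
  refine ⟨h.dPlus_mem_erase, fun d hd => ?_, by rw [hcard, hclose], by rw [h.triEulerTwice_erase, hD.euler]⟩
  -- the first `#∂(G ∖ {u})` darts of the new traversal are distinct, hence all of them
  have himg : (range #(triBdryDarts (G.erase u))).image (triBdryIter (G.erase u) (dPlus u a m)) =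
      triBdryDarts (G.erase u) := by
    apply eq_of_subset_of_card_le
    · intro d' hd'
      obtain ⟨n, -, rfl⟩ := mem_image.1 hd'
      exact triBdryIter_mem h.dPlus_mem_erase n
    · rw [card_image_of_injOn, card_range]
      intro i hi j hj hij
      have hi' := mem_range.1 (mem_coe.1 hi)
      have hj' := mem_range.1 (mem_coe.1 hj)
      rw [hcard] at hi' hj'
      rw [hmain i (by omega), hmain j (by omega)] at hij
      exact h.newIter_injOn hD hi' hj' hij
  rw [← himg] at hd
  obtain ⟨n, hn, rfl⟩ := mem_image.1 hd
  exact ⟨n, mem_range.1 hn, rfl⟩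

end RemovableAt

/-- **Shelling theorem for discs of hexagons.** A disc with at least two hexagons has a boundary
hexagon `u` with a single block of `3, 4` or `5` outside neighbours, and removing it leaves a
disc (based at the dart `RemovableAt.dPlus` following the block); by induction every disc is obtained from a
single hexagon by successively attaching hexagons along `1, 2` or `3` consecutive sides. [folklore] -/
theorem IsTriDisc.exists_removableAt {G : Finset (LatticeModels.Site 2)} {b : LatticeModels.Site 2 × LatticeModels.Site 2} (h : IsTriDisc G b)
    (h2 : 2 ≤ #G) :
    ∃ (u : LatticeModels.Site 2) (a m : Fin 6), RemovableAt G u a m ∧ 3 ≤ m.val ∧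
      IsTriDisc (G.erase u) (RemovableAt.dPlus u a m) := by
  obtain ⟨u, hu, a, m, hb⟩ := h.exists_isOuterBlock h2
  have hR := RemovableAt.of_isOuterBlock hu hb
  exact ⟨u, a, _, hR, hb.1, hR.isTriDisc_erase h⟩

/-- A disc with one hexagon: its boundary is the six darts out of the site. [folklore] -/
theorem IsTriDisc.eq_singleton_of_card_eq_one {G : Finset (LatticeModels.Site 2)} {b : LatticeModels.Site 2 × LatticeModels.Site 2}
    (h : IsTriDisc G b) (h1 : #G = 1) : G = {b.1} := by
  obtain ⟨x, rfl⟩ := card_eq_one.1 h1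
  have := (mem_triBdryDarts.1 h.base_mem).1
  rw [mem_singleton] at this
  rw [this]


end Literature.Probability.Percolation
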